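import Mathlib.Data.Fintype.Card
import Mathlib.Data.Fin.VecNotation
import Mathlib.Data.Finset.Piecewise
import Mathlib.Data.Set.Lattice
import Mathlib.Tactic.FinCases
import HarnessLib

/-!
# Knowledge compilation: NNF circuits, DNNF / d-DNNF, combinatorial rectangle covers, and
# "DNNF size ≥ balanced rectangle cover number" (Bova–Capelli–Mengel–Slivovsky 2016)

Topic `Literature/Computability/Complexity`. Definition request `defn-DNNFRectangleCover` and cite
item `wi-19977` (route QuantumAdvantage/RectangleFree, item `BalancedCoverBound`): the vocabulary of
decomposable negation normal forms (Darwiche 2001) and of (balanced, disjoint) combinatorial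
rectangle covers of a Boolean function, and the transfer theorem of Bova–Capelli–Mengel–Slivovsky,
*Knowledge Compilation Meets Communication Complexity*, IJCAI 2016, pp. 1008–1014 (BCMS), read this
session (`lit read https://www.ijcai.org/Proceedings/16/Papers/147.pdf`, pp. 1009–1012), verbatim:

* §2, NNFs. "We consider circuits in negation normal form, in short NNFs, which are (Boolean)
  circuits over fanin 2 conjunction and disjunction gates, labelled with `∧` and `∨`, whose inputs
  are labeled by literals. The size of an NNF `C`, denoted by `|C|`, is the number of its gates."
  (Footnotes: "we admit circuits formed by a single gate labelled with `0` or `1`, but assume that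
  circuits with at least two gates do not contain constants"; "`|C| > 0`, as `C` contains at least
  the output gate".) "For a gate `g` in an NNF `C` over `X`, we let `C_g` denote the subcircuit of
  `C` rooted at `g` […] `var(C_g) ⊆ X` denote the variables appearing at input gates of `C_g`."
  "Let `g` be an `∧`-gate in an NNF `C`, and let `h` and `h'` be two distinct gates wiring `g` in
  `C`. Then `g` is called decomposable if `var(C_h) ∩ var(C_h') = ∅`. An NNF whose `∧`-gates are
  decomposable is called a decomposable NNF (short, DNNF). Let `g` be an `∨`-gate […]. Then `g`
  is called deterministic if `sat(C_h) ∩ sat(C_h') = ∅`, viewing each circuit involved in the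
  equation as an NNF over `var(C)`. An NNF whose `∨`-gates are all deterministic is called a
  deterministic NNF."
* §2, Rectangles and covers. "A partition `(X₁, X₂)` of `X` into two blocks is called balanced if
  `|X|/3 ≤ min(|X₁|, |X₂|)` […]. A (combinatorial) rectangle over `X` is a function
  `r : {0,1}^X → {0,1}` such that there exist an underlying partition `(X₁, X₂)` of `X` and
  functions `rᵢ : {0,1}^{Xᵢ} → {0,1}` for `i = 1, 2` such that `sat(r) = sat(r₁) × sat(r₂)`. A
  rectangle is called balanced if its underlying partition is balanced. […] A finite set `{rᵢ}` of
  rectangles over `X` is called a rectangle cover of `f` if `sat(f) = ⋃ᵢ sat(rᵢ)`; the rectangle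
  cover is called disjoint if the union is disjoint. A rectangle cover is called balanced if each
  rectangle in the cover is balanced."
* §3, **Theorem 6.** "Let `C` be a (deterministic) DNNF computing a function `f`. Then `f` has a
  balanced (disjoint) rectangle cover of size at most `|C|`." (Proof: iterated gate elimination
  `Cᵢ₊₁ = Cᵢ − gᵢ` choosing `gᵢ` with `|X|/3 ≤ |var(Cᵢ_{gᵢ})| ≤ 2|X|/3` while `2|X|/3 < |var(Cᵢ)|`;
  `sat(Cᵢ, gᵢ)` is a rectangle with blocks `(var(C_{gᵢ}), X ∖ var(C_{gᵢ}))` (Thm. 1); Lemma 4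
  (cover) and Lemma 5 (disjointness in the deterministic case); `X = var(C)` in the proof.)

## Rendering (definitions with bodies; no hypothesis structure)

* `NNFCircuit X m`: an NNF with gate set `Fin m` in TOPOLOGICAL order (a gate only reads gates of
  smaller index — the acyclicity of the DAG, as for the tree's straight-line `Circuit`), node
  labels `NNFCircuit.Node`: constants, literals `(x, polarity)`, binary `∧`, binary `∨`; a
  designated output gate. Size `= m` (BCMS: number of gates, input gates included). Semantics
  `eval`, variables `vars` (`= var(C_g)`), satisfying sets `sat` by well-founded recursion along
  the order. A DAG, not a formula tree: sharing is what DNNF size measures.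
* `IsDecomposable` (DNNF), `IsDeterministic` (d-NNF), `IsConstantFree` (BCMS's standing
  convention: constants only in one-gate circuits) are predicates on `NNFCircuit`. Our `∧`-gates
  may name the same child twice (then decomposability forces that child to be variable-free); BCMS's
  circuits have two distinct in-wires, so every BCMS DNNF is an `NNFCircuit` DNNF and conversely
  every `NNFCircuit` DNNF is a BCMS DNNF after deleting duplicate wires' sources — the fact below is
  stated for our class and is implied by the printed theorem.
* Rectangles live on TOTAL assignments `X → Bool`: the rectangle with block `K : Finset X` and
  sides `A, B ⊆ (X → Bool)` is `{K.piecewise a b | a ∈ A, b ∈ B}` (values of `a` on `K`, of `b` off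
  `K`) — exactly the shape used by the consumer item `BalancedCoverBound`; `IsRectangle K R` iff `R`
  is closed under crossing, `z, z' ∈ R → K.piecewise z z' ∈ R` (PROVED, `isRectangle_iff`), which
  is BCMS's `sat(r) = sat(r₁) × sat(r₂)` for the partition `(K, X ∖ K)`.
* Balanced: `|X| ≤ 3|K| ∧ 3|K| ≤ 2|X|` (`= |X|/3 ≤ min(|K|, |X ∖ K|)` over `ℚ`; symmetric in
  `K ↔ Kᶜ`, PROVED). Covers of size `t` are `Fin t`-indexed families (repetitions allowed; an
  indexed family of `t` rectangles is a set of `≤ t` rectangles and conversely, padding with the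
  EMPTY rectangle, which is a balanced rectangle for any balanced block and disjoint from
  everything), with `⋃ᵢ Rᵢ = f⁻¹(1)`; disjoint = pairwise disjoint family.

## The named fact and its scope

`BCMS2016_balancedCover_of_DNNF` (D-0014): for a finite variable type `X` with `|X| ≠ 1`, every
constant-free DNNF `C` with `m` gates all of whose variables occur (`X = var(C)`, as in the
printed proof) computing `f` yields a balanced rectangle cover of `f` of size `t ≤ m`, pairwise
DISJOINT if `C` is deterministic. **Scope caveat (edge case not covered in print):** for `|X| = 1`
no partition of `X` is balanced (`min(|X₁|, |X₂|) = 0 < 1/3`), so the literal `x` (a one-gate DNNF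
with `var = X = {x}`) has NO balanced cover: Theorem 6 needs `|var(C)| ≠ 1`, which we add as a
hypothesis; `|X| = 0` and `|X| ≥ 2` are as printed. PROVED around it: the crossing characterisation
of rectangles, complements of balanced blocks, the empty/full rectangles, semantic independence from
non-occurring variables (`eval_eq_of_forall_mem_vars`), hence the consumer form for functions that
DEPEND on every variable (`….cover_of_forall_depends`, no `vars` hypothesis), and the size-bound
reformulation (`….le_size`).

## What is NOT here

(The proof of Thm. 6 — certificates, one-hole contexts, elimination rounds — and Thm. 1 for the
circuits `C − F` ARE here since the appendix at the end of this file: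
`BCMS2016_balancedCover_of_DNNF_holds` discharges the named fact.) Structuredness / vtrees, SDD,
FBDD/OBDD and the inclusions
`OBDD ⊆ FBDD ⊆ d-DNNF`, `SDD ⊆ structured d-DNNF` of the knowledge compilation map
(Darwiche–Marquis 2002) — separate definition items if a consumer needs them; multi-partition
communication complexity (BCMS §4).

## References

* [BovaCapelliMengelSlivovsky2016] S. Bova, F. Capelli, S. Mengel, F. Slivovsky, *Knowledge
  Compilation Meets Communication Complexity*, IJCAI 2016, 1008–1014: §2 (definitions), §3 Thm. 1,
  Lemma 4, Lemma 5, Thm. 6.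
* [Darwiche2001] A. Darwiche, *Decomposable negation normal form*, J. ACM 48 (2001) 608–647,
  Def. 2.1–2.2 (NNF, decomposability).
* [DarwicheMarquis2002] A. Darwiche, P. Marquis, *A knowledge compilation map*, JAIR 17 (2002)
  229–264, §2 (determinism, the languages DNNF, d-DNNF, FBDD, OBDD).
-/

namespace Literature.Computability.Complexity

/-! ### NNF circuits as topologically ordered DAGs -/

/-- Node labels of an NNF with gate set `Fin m` over variables `X`: a constant, a literal `x` /
`¬x` (`pos = true` / `false`), or a binary `∧` / `∨` gate reading two gates.
[cite: Darwiche2001, Def. 2.1] [cite: BovaCapelliMengelSlivovsky2016, §2] -/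
inductive NNFCircuit.Node (X : Type*) (m : ℕ) where
  /-- The constant gate `0` / `1`. -/
  | const (b : Bool)
  /-- The literal `x` (`pos = true`) or `¬x` (`pos = false`). -/
  | lit (x : X) (pos : Bool)
  /-- Conjunction of the gates `h₁`, `h₂`. -/
  | and (h₁ h₂ : Fin m)
  /-- Disjunction of the gates `h₁`, `h₂`. -/
  | or (h₁ h₂ : Fin m)
  deriving DecidableEq

/-- The gates read by a node (its in-wires). [cite: BovaCapelliMengelSlivovsky2016, §2] -/
def NNFCircuit.Node.children {X : Type*} {m : ℕ} : NNFCircuit.Node X m → List (Fin m)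
  | .const _ => []
  | .lit _ _ => []
  | .and h₁ h₂ => [h₁, h₂]
  | .or h₁ h₂ => [h₁, h₂]

/-- An **NNF circuit** with `m` gates over the variables `X` (BCMS §2; Darwiche 2001, Def. 2.1):
gates `Fin m` in topological order — gate `i` only reads gates `j < i` (acyclicity) — labelled by
`NNFCircuit.Node`s, with a designated output gate. Its SIZE is `m`, the number of gates, input
gates included (BCMS: "`|C|` is the number of its gates"). A DAG: a gate may be read by several
gates. [cite: BovaCapelliMengelSlivovsky2016, §2] [cite: Darwiche2001, Def. 2.1] -/
structure NNFCircuit (X : Type*) (m : ℕ) where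
  /-- The label of each gate. -/
  node : Fin m → NNFCircuit.Node X m
  /-- Acyclicity: a gate only reads gates of smaller index. -/
  lt_of_mem_children : ∀ i, ∀ j ∈ (node i).children, j < i
  /-- The output gate. -/
  out : Fin m

namespace NNFCircuit

variable {X : Type*} {m : ℕ}

/-- The size `|C|` of an NNF: its number of gates. [cite: BovaCapelliMengelSlivovsky2016, §2] -/
def size (_C : NNFCircuit X m) : ℕ := m

/-- An NNF has at least one gate (the output gate): "`|C| > 0`".
[cite: BovaCapelliMengelSlivovsky2016, §2 (footnote 3)] -/
theorem size_pos (C : NNFCircuit X m) : 0 < C.size := C.out.pos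

/-- The value of gate `i` on the total assignment `z : X → Bool` ("the function `f_C` computed by
an NNF […] is defined in the usual way"), by recursion along the topological order.
[cite: BovaCapelliMengelSlivovsky2016, §2] -/
def eval (C : NNFCircuit X m) (z : X → Bool) (i : Fin m) : Bool :=
  match h : C.node i with
  | .const b => b
  | .lit x pos => z x == pos
  | .and h₁ h₂ =>
    have : h₁ < i := C.lt_of_mem_children i h₁ (by simp [h, Node.children])
    have : h₂ < i := C.lt_of_mem_children i h₂ (by simp [h, Node.children])
    C.eval z h₁ && C.eval z h₂
  | .or h₁ h₂ =>
    have : h₁ < i := C.lt_of_mem_children i h₁ (by simp [h, Node.children])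
    have : h₂ < i := C.lt_of_mem_children i h₂ (by simp [h, Node.children])
    C.eval z h₁ || C.eval z h₂
termination_by i

/-- `var(C_i)`: the variables occurring at the input gates of the subcircuit rooted at gate `i`.
[cite: BovaCapelliMengelSlivovsky2016, §2] -/
def vars [DecidableEq X] (C : NNFCircuit X m) (i : Fin m) : Finset X :=
  match h : C.node i with
  | .const _ => ∅
  | .lit x _ => {x}
  | .and h₁ h₂ =>
    have : h₁ < i := C.lt_of_mem_children i h₁ (by simp [h, Node.children])
    have : h₂ < i := C.lt_of_mem_children i h₂ (by simp [h, Node.children])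
    C.vars h₁ ∪ C.vars h₂
  | .or h₁ h₂ =>
    have : h₁ < i := C.lt_of_mem_children i h₁ (by simp [h, Node.children])
    have : h₂ < i := C.lt_of_mem_children i h₂ (by simp [h, Node.children])
    C.vars h₁ ∪ C.vars h₂
termination_by i

/-- `sat(C_i)`: the total assignments satisfying the subcircuit rooted at gate `i`.
[cite: BovaCapelliMengelSlivovsky2016, §2] -/
def sat (C : NNFCircuit X m) (i : Fin m) : Set (X → Bool) :=
  {z | C.eval z i = true}

/-- The Boolean function `f_C : {0,1}^X → {0,1}` computed by `C` (value of the output gate).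
[cite: BovaCapelliMengelSlivovsky2016, §2] -/
def fn (C : NNFCircuit X m) (z : X → Bool) : Bool :=
  C.eval z C.out

/-- **Decomposable NNF (DNNF)**: the two gates read by every `∧`-gate have disjoint variable sets,
`var(C_{h₁}) ∩ var(C_{h₂}) = ∅`. [cite: Darwiche2001, Def. 2.2] [cite: BovaCapelliMengelSlivovsky2016, §2] -/
def IsDecomposable [DecidableEq X] (C : NNFCircuit X m) : Prop :=
  ∀ (i h₁ h₂ : Fin m), C.node i = .and h₁ h₂ → Disjoint (C.vars h₁) (C.vars h₂)

/-- **Deterministic NNF**: the two gates read by every `∨`-gate have disjoint satisfying sets,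
`sat(C_{h₁}) ∩ sat(C_{h₂}) = ∅` (assignments to all of `X`). A deterministic DNNF is a d-DNNF.
[cite: DarwicheMarquis2002, §2] [cite: BovaCapelliMengelSlivovsky2016, §2] -/
def IsDeterministic (C : NNFCircuit X m) : Prop :=
  ∀ (i h₁ h₂ : Fin m), C.node i = .or h₁ h₂ → Disjoint (C.sat h₁) (C.sat h₂)

/-- **Constant-free** (BCMS's standing convention): constant gates occur only in one-gate
circuits — "we admit circuits formed by a single gate labelled with `0` or `1`, but assume that
circuits with at least two gates do not contain constants".
[cite: BovaCapelliMengelSlivovsky2016, §2 (footnote 2)] -/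
def IsConstantFree (C : NNFCircuit X m) : Prop :=
  ∀ (i : Fin m) (b : Bool), C.node i = .const b → m = 1

/-! #### Unfolding the semantics -/

variable {C : NNFCircuit X m}

/-- A constant gate evaluates to its constant. [folklore] -/
theorem eval_of_const {z : X → Bool} {i : Fin m} {b : Bool} (h : C.node i = .const b) :
    C.eval z i = b := by
  rw [eval]; split <;> simp_all

/-- A literal gate `x` / `¬x` evaluates to `z x` / `¬ z x`. [folklore] -/
theorem eval_of_lit {z : X → Bool} {i : Fin m} {x : X} {pos : Bool} (h : C.node i = .lit x pos) :
    C.eval z i = (z x == pos) := by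
  rw [eval]; split <;> simp_all

/-- An `∧`-gate evaluates to the conjunction of the gates it reads. [folklore] -/
theorem eval_of_and {z : X → Bool} {i h₁ h₂ : Fin m} (h : C.node i = .and h₁ h₂) :
    C.eval z i = (C.eval z h₁ && C.eval z h₂) := by
  rw [eval]; split <;> simp_all

/-- An `∨`-gate evaluates to the disjunction of the gates it reads. [folklore] -/
theorem eval_of_or {z : X → Bool} {i h₁ h₂ : Fin m} (h : C.node i = .or h₁ h₂) :
    C.eval z i = (C.eval z h₁ || C.eval z h₂) := by
  rw [eval]; split <;> simp_all

/-- `var` of a constant gate is empty. [folklore] -/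
theorem vars_of_const [DecidableEq X] {i : Fin m} {b : Bool} (h : C.node i = .const b) :
    C.vars i = ∅ := by
  rw [vars]; split <;> simp_all

/-- `var` of a literal gate is its variable. [folklore] -/
theorem vars_of_lit [DecidableEq X] {i : Fin m} {x : X} {pos : Bool} (h : C.node i = .lit x pos) :
    C.vars i = {x} := by
  rw [vars]; split <;> simp_all

/-- `var(C_{h₁ ∧ h₂}) = var(C_{h₁}) ∪ var(C_{h₂})`. [folklore] -/
theorem vars_of_and [DecidableEq X] {i h₁ h₂ : Fin m} (h : C.node i = .and h₁ h₂) :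
    C.vars i = C.vars h₁ ∪ C.vars h₂ := by
  rw [vars]; split <;> simp_all

/-- `var(C_{h₁ ∨ h₂}) = var(C_{h₁}) ∪ var(C_{h₂})`. [folklore] -/
theorem vars_of_or [DecidableEq X] {i h₁ h₂ : Fin m} (h : C.node i = .or h₁ h₂) :
    C.vars i = C.vars h₁ ∪ C.vars h₂ := by
  rw [vars]; split <;> simp_all

/-! #### Gates only see their own variables -/

/-- The value of a gate depends only on the variables occurring below it: assignments agreeing on
`var(C_i)` give gate `i` the same value. [cite: BovaCapelliMengelSlivovsky2016, §2] -/
theorem eval_eq_of_forall_mem_vars [DecidableEq X] (C : NNFCircuit X m) {z z' : X → Bool}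
    (i : Fin m) (hv : ∀ x ∈ C.vars i, z x = z' x) : C.eval z i = C.eval z' i := by
  match h : C.node i with
  | .const b => rw [eval_of_const h, eval_of_const h]
  | .lit x pos =>
    rw [eval_of_lit h, eval_of_lit h, hv x (by simp [vars_of_lit h])]
  | .and h₁ h₂ =>
    have l₁ : h₁ < i := C.lt_of_mem_children i h₁ (by simp [h, Node.children])
    have l₂ : h₂ < i := C.lt_of_mem_children i h₂ (by simp [h, Node.children])
    rw [eval_of_and h, eval_of_and h,
      C.eval_eq_of_forall_mem_vars h₁ fun x hx ↦ hv x (by simp [vars_of_and h, hx]),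
      C.eval_eq_of_forall_mem_vars h₂ fun x hx ↦ hv x (by simp [vars_of_and h, hx])]
  | .or h₁ h₂ =>
    have l₁ : h₁ < i := C.lt_of_mem_children i h₁ (by simp [h, Node.children])
    have l₂ : h₂ < i := C.lt_of_mem_children i h₂ (by simp [h, Node.children])
    rw [eval_of_or h, eval_of_or h,
      C.eval_eq_of_forall_mem_vars h₁ fun x hx ↦ hv x (by simp [vars_of_or h, hx]),
      C.eval_eq_of_forall_mem_vars h₂ fun x hx ↦ hv x (by simp [vars_of_or h, hx])]
termination_by i

/-- Hence `f_C` does not depend on a variable that does not occur in `C`: flipping it does not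
change the output. [cite: BovaCapelliMengelSlivovsky2016, §2] -/
theorem fn_update_eq_of_not_mem_vars [DecidableEq X] (C : NNFCircuit X m) {x : X}
    (hx : x ∉ C.vars C.out) (z : X → Bool) (b : Bool) :
    C.fn (Function.update z x b) = C.fn z :=
  C.eval_eq_of_forall_mem_vars C.out fun y hy ↦
    Function.update_of_ne (show y ≠ x from fun h ↦ hx (h ▸ hy)) b z

/-- A variable on which `f_C` DEPENDS (some flip changes the output) occurs in `C`.
[cite: BovaCapelliMengelSlivovsky2016, §2] -/
theorem mem_vars_out_of_fn_update_ne [DecidableEq X] (C : NNFCircuit X m) {x : X} {z : X → Bool}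
    {b : Bool} (h : C.fn (Function.update z x b) ≠ C.fn z) : x ∈ C.vars C.out :=
  by_contra fun hx ↦ h (C.fn_update_eq_of_not_mem_vars hx z b)

/-- If `f_C` depends on every variable then every variable occurs: `var(C) = X`.
[cite: BovaCapelliMengelSlivovsky2016, §2] -/
theorem vars_out_eq_univ_of_forall_depends [Fintype X] [DecidableEq X] (C : NNFCircuit X m)
    (h : ∀ x : X, ∃ (z : X → Bool) (b : Bool), C.fn (Function.update z x b) ≠ C.fn z) :
    C.vars C.out = Finset.univ :=
  Finset.eq_univ_of_forall fun x ↦ by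
    obtain ⟨z, b, hz⟩ := h x
    exact C.mem_vars_out_of_fn_update_ne hz

end NNFCircuit

/-! ### Combinatorial rectangles, balanced blocks and rectangle covers -/

section Rectangles

variable {X : Type*} [DecidableEq X]

/-- The **combinatorial rectangle** with block `K` and sides `A`, `B`: the total assignments
`K.piecewise a b` (`a` on `K`, `b` off `K`) with `a ∈ A`, `b ∈ B` — BCMS's `sat(r₁) × sat(r₂)`
for the partition `(K, X ∖ K)`, with the sides given by total assignments (only `a|_K` and
`b|_{X∖K}` matter). [cite: BovaCapelliMengelSlivovsky2016, §2 (Rectangles and Covers)] -/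
def rectangle (K : Finset X) (A B : Set (X → Bool)) : Set (X → Bool) :=
  {z | ∃ a ∈ A, ∃ b ∈ B, K.piecewise a b = z}

/-- `R ⊆ {0,1}^X` is a (combinatorial) rectangle with underlying partition `(K, X ∖ K)`.
[cite: BovaCapelliMengelSlivovsky2016, §2 (Rectangles and Covers)] -/
def IsRectangle (K : Finset X) (R : Set (X → Bool)) : Prop :=
  ∃ A B : Set (X → Bool), rectangle K A B = R

omit [DecidableEq X] in
/-- Crossing twice on the same block keeps the first `K`-part: `(a ▹ b) ▹ c = a ▹ c`. [folklore] -/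
theorem piecewise_piecewise_left (K : Finset X) [∀ x, Decidable (x ∈ K)] (a b c : X → Bool) :
    K.piecewise (K.piecewise a b) c = K.piecewise a c := by
  ext x; by_cases hx : x ∈ K <;> simp [Finset.piecewise, hx]

omit [DecidableEq X] in
/-- `a ▹ (b ▹ c) = a ▹ c`. [folklore] -/
theorem piecewise_piecewise_right (K : Finset X) [∀ x, Decidable (x ∈ K)] (a b c : X → Bool) :
    K.piecewise a (K.piecewise b c) = K.piecewise a c := by
  ext x; by_cases hx : x ∈ K <;> simp [Finset.piecewise, hx]

/-- Membership in a rectangle. [cite: BovaCapelliMengelSlivovsky2016, §2] -/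
theorem mem_rectangle_iff {K : Finset X} {A B : Set (X → Bool)} {z : X → Bool} :
    z ∈ rectangle K A B ↔ ∃ a ∈ A, ∃ b ∈ B, K.piecewise a b = z :=
  Iff.rfl

/-- `a ▹ b` lies in the rectangle `A ×_K B` for `a ∈ A`, `b ∈ B`. [cite: BovaCapelliMengelSlivovsky2016, §2] -/
theorem piecewise_mem_rectangle (K : Finset X) {A B : Set (X → Bool)} {a b : X → Bool} (ha : a ∈ A)
    (hb : b ∈ B) : K.piecewise a b ∈ rectangle K A B :=
  ⟨a, ha, b, hb, rfl⟩

/-- A rectangle in the side form is a rectangle. [cite: BovaCapelliMengelSlivovsky2016, §2] -/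
theorem isRectangle_rectangle (K : Finset X) (A B : Set (X → Bool)) : IsRectangle K (rectangle K A B) :=
  ⟨A, B, rfl⟩

/-- Rectangles are closed under crossing: `z, z' ∈ R ⇒ (z on K, z' off K) ∈ R`.
[cite: BovaCapelliMengelSlivovsky2016, §2] -/
theorem IsRectangle.piecewise_mem {K : Finset X} {R : Set (X → Bool)} (h : IsRectangle K R)
    {z z' : X → Bool} (hz : z ∈ R) (hz' : z' ∈ R) : K.piecewise z z' ∈ R := by
  obtain ⟨A, B, rfl⟩ := h
  obtain ⟨a, ha, b, -, rfl⟩ := hz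
  obtain ⟨a', -, b', hb', rfl⟩ := hz'
  rw [piecewise_piecewise_left, piecewise_piecewise_right]
  exact piecewise_mem_rectangle K ha hb'

/-- **Crossing characterisation**: `R` is a rectangle with blocks `(K, X ∖ K)` iff it is closed
under crossing (then `R = R|_K × R|_{X∖K}`, i.e. `R = rectangle K R R`).
[cite: BovaCapelliMengelSlivovsky2016, §2] -/
theorem isRectangle_iff {K : Finset X} {R : Set (X → Bool)} :
    IsRectangle K R ↔ ∀ z ∈ R, ∀ z' ∈ R, K.piecewise z z' ∈ R := by
  refine ⟨fun h z hz z' hz' ↦ h.piecewise_mem hz hz', fun h ↦ ⟨R, R, Set.ext fun z ↦ ⟨?_, ?_⟩⟩⟩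
  · rintro ⟨a, ha, b, hb, rfl⟩
    exact h a ha b hb
  · exact fun hz ↦ ⟨z, hz, z, hz, Finset.piecewise_same K z⟩

/-- The empty set is a rectangle (empty sides) for every block. [folklore] -/
theorem isRectangle_empty (K : Finset X) : IsRectangle K (∅ : Set (X → Bool)) :=
  isRectangle_iff.2 fun _ h ↦ h.elim

/-- The whole cube is a rectangle for every block. [folklore] -/
theorem isRectangle_univ (K : Finset X) : IsRectangle K (Set.univ : Set (X → Bool)) :=
  isRectangle_iff.2 fun _ _ _ _ ↦ Set.mem_univ _

/-- A rectangle for `K` is a rectangle for the complementary block (swap the sides).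
[cite: BovaCapelliMengelSlivovsky2016, §2] -/
theorem IsRectangle.compl [Fintype X] {K : Finset X} {R : Set (X → Bool)} (h : IsRectangle K R) :
    IsRectangle Kᶜ R :=
  isRectangle_iff.2 fun z hz z' hz' ↦ by
    rw [Finset.piecewise_compl]
    exact h.piecewise_mem hz' hz

end Rectangles

section Balanced

variable {X : Type*} [Fintype X]

/-- The block `K` (i.e. the partition `(K, X ∖ K)`) is **balanced**: `|X|/3 ≤ min(|K|, |X ∖ K|)`,
equivalently `max ≤ 2|X|/3`; in `ℕ`: `|X| ≤ 3|K|` and `3|K| ≤ 2|X|`.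
[cite: BovaCapelliMengelSlivovsky2016, §2 (Rectangles and Covers)] -/
def IsBalancedBlock (K : Finset X) : Prop :=
  Fintype.card X ≤ 3 * K.card ∧ 3 * K.card ≤ 2 * Fintype.card X

/-- Balance is symmetric in the two blocks. [cite: BovaCapelliMengelSlivovsky2016, §2] -/
theorem isBalancedBlock_compl [DecidableEq X] {K : Finset X} :
    IsBalancedBlock Kᶜ ↔ IsBalancedBlock K := by
  simp only [IsBalancedBlock, Finset.card_compl]
  have := K.card_le_univ
  omega

/-- No block of a ONE-element variable set is balanced (`min(|K|, |X ∖ K|) = 0 < 1/3`): the edge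
case of Theorem 6 (module docstring). [cite: BovaCapelliMengelSlivovsky2016, §2] -/
theorem IsBalancedBlock.card_ne_one {K : Finset X} (h : IsBalancedBlock K) : Fintype.card X ≠ 1 := by
  unfold IsBalancedBlock at h; omega

/-- Conversely, if `|X| ≠ 1` a balanced block exists (any `K` with `|K| = ⌈|X|/3⌉`). [folklore] -/
theorem exists_isBalancedBlock (hX : Fintype.card X ≠ 1) : ∃ K : Finset X, IsBalancedBlock K := by
  obtain ⟨K, -, hK⟩ := Finset.exists_subset_card_eq
    (show (Fintype.card X + 2) / 3 ≤ (Finset.univ : Finset X).card by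
      rw [Finset.card_univ]; omega)
  exact ⟨K, by unfold IsBalancedBlock; omega⟩

end Balanced

section Covers

variable {X : Type*} [Fintype X] [DecidableEq X]

/-- **`f` has a balanced rectangle cover of size `t`**: `t` rectangles `Rᵢ`, each with its own
balanced block `Kᵢ`, with `⋃ᵢ Rᵢ = f⁻¹(1)` (an indexed family; repetitions allowed, so "of size
`t`" is "a set of at most `t` rectangles"). [cite: BovaCapelliMengelSlivovsky2016, §2 (Rectangles and Covers)] -/
def HasBalancedRectangleCover (f : (X → Bool) → Bool) (t : ℕ) : Prop :=
  ∃ (K : Fin t → Finset X) (R : Fin t → Set (X → Bool)),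
    (∀ i, IsBalancedBlock (K i) ∧ IsRectangle (K i) (R i)) ∧ ⋃ i, R i = {z | f z = true}

/-- **`f` has a balanced DISJOINT rectangle cover of size `t`**: as above with the `Rᵢ` pairwise
disjoint ("the union is disjoint"). [cite: BovaCapelliMengelSlivovsky2016, §2 (Rectangles and Covers)] -/
def HasBalancedDisjointRectangleCover (f : (X → Bool) → Bool) (t : ℕ) : Prop :=
  ∃ (K : Fin t → Finset X) (R : Fin t → Set (X → Bool)),
    (∀ i, IsBalancedBlock (K i) ∧ IsRectangle (K i) (R i)) ∧
      Pairwise (fun i j ↦ Disjoint (R i) (R j)) ∧ ⋃ i, R i = {z | f z = true}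

/-- A disjoint cover is a cover. [cite: BovaCapelliMengelSlivovsky2016, §2] -/
theorem HasBalancedDisjointRectangleCover.hasBalancedRectangleCover {f : (X → Bool) → Bool} {t : ℕ}
    (h : HasBalancedDisjointRectangleCover f t) : HasBalancedRectangleCover f t := by
  obtain ⟨K, R, hKR, -, hU⟩ := h
  exact ⟨K, R, hKR, hU⟩

/-- A balanced cover forces `|X| ≠ 1` as soon as it has a member. [cite: BovaCapelliMengelSlivovsky2016, §2] -/
theorem HasBalancedRectangleCover.card_ne_one {f : (X → Bool) → Bool} {t : ℕ}
    (h : HasBalancedRectangleCover f t) (ht : 0 < t) : Fintype.card X ≠ 1 := by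
  obtain ⟨K, R, hKR, -⟩ := h
  exact (hKR ⟨0, ht⟩).1.card_ne_one

/-- Covers may be padded with empty rectangles (on a balanced block, which exists as `|X| ≠ 1`):
a cover of size `t` gives one of every size `t' ≥ t`. [folklore] -/
theorem HasBalancedRectangleCover.mono (hX : Fintype.card X ≠ 1) {f : (X → Bool) → Bool} {t t' : ℕ}
    (h : HasBalancedRectangleCover f t) (ht : t ≤ t') : HasBalancedRectangleCover f t' := by
  obtain ⟨K, R, hKR, hU⟩ := h
  obtain ⟨K₀, hK₀⟩ := exists_isBalancedBlock hX
  refine ⟨fun i ↦ if hi : (i : ℕ) < t then K ⟨i, hi⟩ else K₀,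
    fun i ↦ if hi : (i : ℕ) < t then R ⟨i, hi⟩ else ∅, fun i ↦ ?_, ?_⟩
  · by_cases hi : (i : ℕ) < t
    · simpa [hi] using hKR ⟨i, hi⟩
    · simpa [hi] using ⟨hK₀, isRectangle_empty K₀⟩
  · rw [← hU]
    ext z
    simp only [Set.mem_iUnion]
    constructor
    · rintro ⟨i, hi⟩
      by_cases h : (i : ℕ) < t
      · exact ⟨⟨i, h⟩, by simpa [h] using hi⟩
      · simp [h] at hi
    · rintro ⟨i, hi⟩
      exact ⟨⟨i, lt_of_lt_of_le i.2 ht⟩, by simpa [i.2] using hi⟩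

/-- The same padding for disjoint covers (empty rectangles are disjoint from everything). [folklore] -/
theorem HasBalancedDisjointRectangleCover.mono (hX : Fintype.card X ≠ 1) {f : (X → Bool) → Bool}
    {t t' : ℕ} (h : HasBalancedDisjointRectangleCover f t) (ht : t ≤ t') :
    HasBalancedDisjointRectangleCover f t' := by
  obtain ⟨K, R, hKR, hD, hU⟩ := h
  obtain ⟨K₀, hK₀⟩ := exists_isBalancedBlock hX
  refine ⟨fun i ↦ if hi : (i : ℕ) < t then K ⟨i, hi⟩ else K₀,
    fun i ↦ if hi : (i : ℕ) < t then R ⟨i, hi⟩ else ∅, fun i ↦ ?_, fun i j hij ↦ ?_, ?_⟩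
  · by_cases hi : (i : ℕ) < t
    · simpa [hi] using hKR ⟨i, hi⟩
    · simpa [hi] using ⟨hK₀, isRectangle_empty K₀⟩
  · by_cases hi : (i : ℕ) < t
    · by_cases hj : (j : ℕ) < t
      · have hne : (⟨i, hi⟩ : Fin t) ≠ ⟨j, hj⟩ := fun h ↦ hij (Fin.ext (by simpa using congrArg Fin.val h))
        simpa [hi, hj] using hD hne
      · simp [hj]
    · simp [hi]
  · rw [← hU]
    ext z
    simp only [Set.mem_iUnion]
    constructor
    · rintro ⟨i, hi⟩
      by_cases h : (i : ℕ) < t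
      · exact ⟨⟨i, h⟩, by simpa [h] using hi⟩
      · simp [h] at hi
    · rintro ⟨i, hi⟩
      exact ⟨⟨i, lt_of_lt_of_le i.2 ht⟩, by simpa [i.2] using hi⟩

end Covers

/-! ### The named fact: DNNF size bounds (balanced, disjoint) rectangle cover numbers -/

/-- **Bova–Capelli–Mengel–Slivovsky 2016, Thm. 6 (knowledge compilation meets communication
complexity).** "Let `C` be a (deterministic) DNNF computing a function `f`. Then `f` has a
balanced (disjoint) rectangle cover of size at most `|C|`." Rendering: for a finite variable type
`X` with `|X| ≠ 1` (edge case, module docstring), a constant-free DNNF `C` with `m` gates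
(`NNFCircuit X m`, gates in topological order, `|C| = m`) in which every variable occurs
(`X = var(C)`, as in the printed proof), computing `f = C.fn`: `f` has a balanced rectangle cover
of some size `t ≤ m`, and a balanced pairwise-disjoint one if `C` is moreover deterministic.
[cite: BovaCapelliMengelSlivovsky2016, §3 Thm. 6] -/
def BCMS2016_balancedCover_of_DNNF : Prop :=
  ∀ (X : Type) [Fintype X] [DecidableEq X], Fintype.card X ≠ 1 →
    ∀ (m : ℕ) (C : NNFCircuit X m), C.IsDecomposable → C.IsConstantFree →
      C.vars C.out = Finset.univ →
        (∃ t ≤ m, HasBalancedRectangleCover C.fn t) ∧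
          (C.IsDeterministic → ∃ t ≤ m, HasBalancedDisjointRectangleCover C.fn t)

namespace BCMS2016_balancedCover_of_DNNF

variable {X : Type} [Fintype X] [DecidableEq X] {m : ℕ} {C : NNFCircuit X m}

/-- DNNF ⇒ balanced cover of size `≤ |C|`. [cite: BovaCapelliMengelSlivovsky2016, §3 Thm. 6] -/
theorem cover (h : BCMS2016_balancedCover_of_DNNF) (hX : Fintype.card X ≠ 1)
    (hd : C.IsDecomposable) (hc : C.IsConstantFree) (hv : C.vars C.out = Finset.univ) :
    ∃ t ≤ m, HasBalancedRectangleCover C.fn t :=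
  (h X hX m C hd hc hv).1

/-- d-DNNF ⇒ balanced DISJOINT cover of size `≤ |C|`. [cite: BovaCapelliMengelSlivovsky2016, §3 Thm. 6] -/
theorem disjointCover (h : BCMS2016_balancedCover_of_DNNF) (hX : Fintype.card X ≠ 1)
    (hd : C.IsDecomposable) (hc : C.IsConstantFree) (hv : C.vars C.out = Finset.univ)
    (hdet : C.IsDeterministic) : ∃ t ≤ m, HasBalancedDisjointRectangleCover C.fn t :=
  (h X hX m C hd hc hv).2 hdet

/-- Padded to size exactly `|C| = m`. [cite: BovaCapelliMengelSlivovsky2016, §3 Thm. 6] -/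
theorem cover_size (h : BCMS2016_balancedCover_of_DNNF) (hX : Fintype.card X ≠ 1)
    (hd : C.IsDecomposable) (hc : C.IsConstantFree) (hv : C.vars C.out = Finset.univ) :
    HasBalancedRectangleCover C.fn m := by
  obtain ⟨t, ht, hcov⟩ := h.cover hX hd hc hv
  exact hcov.mono hX ht

/-- **Size lower bound form** (the use in route RectangleFree): if every balanced rectangle cover
of `f_C` has at least `s` members, then `|C| ≥ s`. [cite: BovaCapelliMengelSlivovsky2016, §3 Thm. 6 and §4] -/
theorem le_size (h : BCMS2016_balancedCover_of_DNNF) (hX : Fintype.card X ≠ 1)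
    (hd : C.IsDecomposable) (hc : C.IsConstantFree) (hv : C.vars C.out = Finset.univ) {s : ℕ}
    (hs : ∀ t, HasBalancedRectangleCover C.fn t → s ≤ t) : s ≤ C.size := by
  obtain ⟨t, ht, hcov⟩ := h.cover hX hd hc hv
  exact (hs t hcov).trans ht

/-- The same for deterministic DNNFs and DISJOINT covers. [cite: BovaCapelliMengelSlivovsky2016, §3 Thm. 6 and §4] -/
theorem le_size_of_isDeterministic (h : BCMS2016_balancedCover_of_DNNF) (hX : Fintype.card X ≠ 1)
    (hd : C.IsDecomposable) (hc : C.IsConstantFree) (hv : C.vars C.out = Finset.univ)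
    (hdet : C.IsDeterministic) {s : ℕ}
    (hs : ∀ t, HasBalancedDisjointRectangleCover C.fn t → s ≤ t) : s ≤ C.size := by
  obtain ⟨t, ht, hcov⟩ := h.disjointCover hX hd hc hv hdet
  exact (hs t hcov).trans ht

/-- **Consumer form without the `var(C) = X` bookkeeping**: if the computed function depends on
every variable (some flip of each variable changes the output) — as the indicator of the
exponentiation graph does — the hypothesis `C.vars C.out = univ` is automatic.
[cite: BovaCapelliMengelSlivovsky2016, §3 Thm. 6] -/
theorem cover_of_forall_depends (h : BCMS2016_balancedCover_of_DNNF) (hX : Fintype.card X ≠ 1)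
    (hd : C.IsDecomposable) (hc : C.IsConstantFree)
    (hdep : ∀ x : X, ∃ (z : X → Bool) (b : Bool), C.fn (Function.update z x b) ≠ C.fn z) :
    ∃ t ≤ m, HasBalancedRectangleCover C.fn t :=
  h.cover hX hd hc (C.vars_out_eq_univ_of_forall_depends hdep)

end BCMS2016_balancedCover_of_DNNF

/-! ### A worked example (non-vacuity): the XNOR d-DNNF `(x₀ ∧ x₁) ∨ (¬x₀ ∧ ¬x₁)` -/

namespace NNFCircuit

/-- The seven-gate NNF `(x₀ ∧ x₁) ∨ (¬x₀ ∧ ¬x₁)` over two variables: gates `0–3` the four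
literals, `4 = 0 ∧ 1`, `5 = 2 ∧ 3`, `6 = 4 ∨ 5` (output). [folklore] -/
def xnor : NNFCircuit (Fin 2) 7 where
  node := ![.lit 0 true, .lit 1 true, .lit 0 false, .lit 1 false, .and 0 1, .and 2 3, .or 4 5]
  lt_of_mem_children := by decide
  out := 6

/-- `xnor` computes `x₀ ↔ x₁`. [folklore] -/
theorem xnor_fn (z : Fin 2 → Bool) : xnor.fn z = (z 0 == z 1) := by
  have h6 : xnor.eval z 6 = (xnor.eval z 4 || xnor.eval z 5) := eval_of_or rfl
  have h4 : xnor.eval z 4 = (xnor.eval z 0 && xnor.eval z 1) := eval_of_and rfl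
  have h5 : xnor.eval z 5 = (xnor.eval z 2 && xnor.eval z 3) := eval_of_and rfl
  have h0 : xnor.eval z 0 = (z 0 == true) := eval_of_lit rfl
  have h1 : xnor.eval z 1 = (z 1 == true) := eval_of_lit rfl
  have h2 : xnor.eval z 2 = (z 0 == false) := eval_of_lit rfl
  have h3 : xnor.eval z 3 = (z 1 == false) := eval_of_lit rfl
  rw [fn, show xnor.out = 6 from rfl, h6, h4, h5, h0, h1, h2, h3]
  cases z 0 <;> cases z 1 <;> rfl

/-- The variable sets of the gates of `xnor`. [folklore] -/
theorem xnor_vars :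
    xnor.vars 0 = {0} ∧ xnor.vars 1 = {1} ∧ xnor.vars 2 = {0} ∧ xnor.vars 3 = {1} ∧
      xnor.vars 4 = {0, 1} ∧ xnor.vars 5 = {0, 1} ∧ xnor.vars 6 = {0, 1} := by
  have h0 : xnor.vars 0 = {0} := vars_of_lit rfl
  have h1 : xnor.vars 1 = {1} := vars_of_lit rfl
  have h2 : xnor.vars 2 = {0} := vars_of_lit rfl
  have h3 : xnor.vars 3 = {1} := vars_of_lit rfl
  have h4 : xnor.vars 4 = {0, 1} := by rw [vars_of_and (h₁ := 0) (h₂ := 1) rfl, h0, h1]; decide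
  have h5 : xnor.vars 5 = {0, 1} := by rw [vars_of_and (h₁ := 2) (h₂ := 3) rfl, h2, h3]; decide
  have h6 : xnor.vars 6 = {0, 1} := by rw [vars_of_or (h₁ := 4) (h₂ := 5) rfl, h4, h5]; decide
  exact ⟨h0, h1, h2, h3, h4, h5, h6⟩

/-- Every variable occurs in `xnor`. [folklore] -/
theorem xnor_vars_out : xnor.vars xnor.out = Finset.univ := by
  rw [show xnor.out = 6 from rfl, xnor_vars.2.2.2.2.2.2]; decide

/-- The `∧`-gates of `xnor` are `4 = 0 ∧ 1` and `5 = 2 ∧ 3`. [folklore] -/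
theorem xnor_node_eq_and : ∀ i h₁ h₂ : Fin 7, xnor.node i = .and h₁ h₂ →
    h₁ = 0 ∧ h₂ = 1 ∨ h₁ = 2 ∧ h₂ = 3 := by
  decide

/-- The only `∨`-gate of `xnor` is `6 = 4 ∨ 5`. [folklore] -/
theorem xnor_node_eq_or : ∀ i h₁ h₂ : Fin 7, xnor.node i = .or h₁ h₂ → h₁ = 4 ∧ h₂ = 5 := by
  decide

/-- `xnor` has no constant gate. [folklore] -/
theorem xnor_node_ne_const : ∀ (i : Fin 7) (b : Bool), xnor.node i ≠ .const b := by
  decide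

/-- `xnor` is decomposable (its two `∧`-gates join `{x₀}` with `{x₁}`). [folklore] -/
theorem xnor_isDecomposable : xnor.IsDecomposable := by
  intro i h₁ h₂ h
  obtain ⟨e0, e1, e2, e3, -, -, -⟩ := xnor_vars
  rcases xnor_node_eq_and i h₁ h₂ h with ⟨rfl, rfl⟩ | ⟨rfl, rfl⟩
  · rw [e0, e1]; decide
  · rw [e2, e3]; decide

/-- `xnor` is deterministic (its `∨`-gate joins `x₀ ∧ x₁` with `¬x₀ ∧ ¬x₁`). [folklore] -/
theorem xnor_isDeterministic : xnor.IsDeterministic := by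
  intro i h₁ h₂ h
  obtain ⟨rfl, rfl⟩ := xnor_node_eq_or i h₁ h₂ h
  rw [Set.disjoint_left]
  intro z hz4 hz5
  have h4 : xnor.eval z 4 = (xnor.eval z 0 && xnor.eval z 1) := eval_of_and rfl
  have h5 : xnor.eval z 5 = (xnor.eval z 2 && xnor.eval z 3) := eval_of_and rfl
  have h0 : xnor.eval z 0 = (z 0 == true) := eval_of_lit rfl
  have h2 : xnor.eval z 2 = (z 0 == false) := eval_of_lit rfl
  simp only [sat, Set.mem_setOf_eq, h4, h5, h0, h2, Bool.and_eq_true] at hz4 hz5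
  have a := hz4.1
  have b := hz5.1
  revert a b
  cases z 0 <;> simp

/-- `xnor` is constant-free. [folklore] -/
theorem xnor_isConstantFree : xnor.IsConstantFree :=
  fun i b h ↦ absurd h (xnor_node_ne_const i b)

/-- `XNOR⁻¹(1) = {11, 00}` has a balanced disjoint rectangle cover of size `2 ≤ 7 = |xnor|`: the two
points, each a one-point rectangle for the (balanced) block `{x₀}` — consistent with Theorem 6, and
witnessing that the cover predicates are inhabited. [folklore] -/
theorem xnor_hasBalancedDisjointRectangleCover : HasBalancedDisjointRectangleCover xnor.fn 2 := by
  refine ⟨fun _ ↦ {0}, fun i ↦ {fun _ ↦ decide (i = 0)},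
    fun i ↦ ⟨by simp [IsBalancedBlock], ?_⟩, ?_, ?_⟩
  · exact isRectangle_iff.2 fun z hz z' hz' ↦ by
      rw [Set.mem_singleton_iff] at hz hz' ⊢
      subst hz hz'
      exact Finset.piecewise_same _ _
  · intro i j hij
    rw [Set.disjoint_singleton]
    intro h
    have h0 := congrFun h 0
    simp only [decide_eq_decide] at h0
    exact hij (by fin_cases i <;> fin_cases j <;> simp_all)
  · ext z
    simp only [Set.mem_iUnion, Set.mem_singleton_iff, Set.mem_setOf_eq, xnor_fn]
    constructor
    · rintro ⟨i, rfl⟩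
      simp
    · intro h
      refine ⟨if z 0 then 0 else 1, funext fun k ↦ ?_⟩
      fin_cases k <;> cases h0 : z 0 <;> cases h1 : z 1 <;> simp_all

end NNFCircuit

end Literature.Computability.Complexity

/-!
## Appendix: proof of Theorem 6 — discharge of `BCMS2016_balancedCover_of_DNNF`

`BCMS2016_balancedCover_of_DNNF_holds : BCMS2016_balancedCover_of_DNNF` is PROVED below, so the
named fact above carries no debt. (The proof does not use the hypotheses `IsConstantFree` and
`var(C) = X` of the fact: Theorem 6 holds for every decomposable `NNFCircuit` once `|X| ≠ 1`,
`NNFCircuit.exists_balancedCover`.) The argument is a certificate calculus equivalent to the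
printed gate-elimination proof [BovaCapelliMengelSlivovsky2016, §3] but avoiding any rewriting
of circuits:

* a *certificate* (BCMS16 §3, `NNFCircuit.PT`) is a tree of gates that is `NNFCircuit.Valid` when
  it follows the circuit (both children at an `∧`-gate, one at an `∨`-gate, leaves on literal /
  `const true` gates); `sat(C_k) = ⋃_T sat(T)` over the valid certificates rooted at `k`
  (`NNFCircuit.eval_eq_true_iff`, BCMS16 eq. (2));
* a *one-hole context* (`NNFCircuit.Ctx`) is a certificate with one sub-certificate removed;
  plugging any valid certificate of the hole's gate gives a valid certificate
  (`NNFCircuit.Valid.plug_congr`, the exchange step in the proofs of BCMS16 Lemma 2 / Theorem 1),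
  and DECOMPOSABILITY makes the variables of the context avoid those of every certificate of the
  hole's gate (`NNFCircuit.Valid.cvars_disjoint`, BCMS16 Lemma 2) — the only use of
  decomposability;
* for a set `F` of eliminated gates, `gateRect F g` = (assignments satisfying an `F`-avoiding
  certificate of gate `g`) ∩ (assignments satisfying an `F`-avoiding context from the output to
  `g`) — this is `sat(C − F, g)` — is a rectangle w.r.t. `VF F g`, the variables of the
  `F`-avoiding certificates of `g` (`NNFCircuit.isRectangle_gateRect`, BCMS16 Theorem 1 for the
  circuit `C − F`);
* a descent from the output finds `g` with `|X| < 3 |VF F g| ≤ 2 |X|` (`NNFCircuit.descend_window`,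
  BCMS16 proof of Thm. 6; the root case is padded, `NNFCircuit.pad`), `g` joins `F`, and after at
  most `m` rounds (`NNFCircuit.rounds`) no certificate of the output avoids `F`; an assignment is
  caught in the round eliminating the first gate of its certificate (`NNFCircuit.exists_mem_rounds`,
  BCMS16 Lemma 4);
* under DETERMINISM an assignment satisfies at most one certificate of a gate
  (`NNFCircuit.Valid.eq_of_sat`, BCMS16 Lemma 5), whence the rectangles of different rounds are
  disjoint (`NNFCircuit.gateRect_disjoint`).
-/

namespace Literature.Computability.Complexity

namespace NNFCircuit

variable {X : Type*} {m : ℕ}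

/-! #### Certificates -/

/-- Certificate shapes: a tree of gates following an NNF downwards, keeping both children at an
`∧`-gate and one child at an `∨`-gate, down to literal / constant-`true` leaves (BCMS16 §3,
"certificate"; validity w.r.t. a circuit is `NNFCircuit.Valid`).
[cite: BovaCapelliMengelSlivovsky2016, §3 (p. 1010)] -/
inductive PT (X : Type*) (m : ℕ) : Type _
  /-- leaf on a `const true` gate `k` -/
  | const (k : Fin m)
  /-- leaf on the literal gate `k` labelled `x = b` -/
  | lit (k : Fin m) (x : X) (b : Bool)
  /-- `∧`-gate `k` with certificates of both children -/
  | and (k : Fin m) (l r : PT X m)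
  /-- `∨`-gate `k` with a certificate of its first child -/
  | orL (k : Fin m) (t : PT X m)
  /-- `∨`-gate `k` with a certificate of its second child -/
  | orR (k : Fin m) (t : PT X m)

namespace PT

/-- The root gate of a certificate. [cite: BovaCapelliMengelSlivovsky2016, §3 (p. 1010)] -/
def root : PT X m → Fin m
  | const k => k
  | lit k _ _ => k
  | and k _ _ => k
  | orL k _ => k
  | orR k _ => k

/-- The gates occurring in a certificate. [cite: BovaCapelliMengelSlivovsky2016, §3 (p. 1010)] -/
def gates : PT X m → List (Fin m)
  | const k => [k]
  | lit k _ _ => [k]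
  | and k l r => k :: (l.gates ++ r.gates)
  | orL k t => k :: t.gates
  | orR k t => k :: t.gates

/-- The variables at the leaves of a certificate (`var(T)`).
[cite: BovaCapelliMengelSlivovsky2016, §3 (p. 1010)] -/
def pvars : PT X m → List X
  | const _ => []
  | lit _ x _ => [x]
  | and _ l r => l.pvars ++ r.pvars
  | orL _ t => t.pvars
  | orR _ t => t.pvars

/-- `z ∈ sat(T)`: the assignment satisfies every literal of the certificate.
[cite: BovaCapelliMengelSlivovsky2016, §3 (p. 1010)] -/
def Sat (z : X → Bool) : PT X m → Prop
  | const _ => True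
  | lit _ x b => z x = b
  | and _ l r => Sat z l ∧ Sat z r
  | orL _ t => Sat z t
  | orR _ t => Sat z t

/-- The certificate avoids the set `F` of (eliminated) gates.
[cite: BovaCapelliMengelSlivovsky2016, §3 (Prop. 3, p. 1011)] -/
def Avoids (F : Finset (Fin m)) (t : PT X m) : Prop := ∀ g ∈ t.gates, g ∉ F

/-- Unfolding `Sat` at a constant leaf. [folklore] -/
@[simp] theorem sat_const (z : X → Bool) (k : Fin m) : (const k : PT X m).Sat z ↔ True := Iff.rfl
/-- Unfolding `Sat` at a literal leaf. [folklore] -/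
@[simp] theorem sat_lit (z : X → Bool) (k : Fin m) (x : X) (b : Bool) :
    (lit k x b : PT X m).Sat z ↔ z x = b := Iff.rfl
/-- Unfolding `Sat` at an `∧`-node. [folklore] -/
@[simp] theorem sat_and (z : X → Bool) (k : Fin m) (l r : PT X m) :
    (and k l r).Sat z ↔ l.Sat z ∧ r.Sat z := Iff.rfl
/-- Unfolding `Sat` at an `∨`-node (first child). [folklore] -/
@[simp] theorem sat_orL (z : X → Bool) (k : Fin m) (t : PT X m) : (orL k t).Sat z ↔ t.Sat z :=
  Iff.rfl
/-- Unfolding `Sat` at an `∨`-node (second child). [folklore] -/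
@[simp] theorem sat_orR (z : X → Bool) (k : Fin m) (t : PT X m) : (orR k t).Sat z ↔ t.Sat z :=
  Iff.rfl

/-- The root occurs in the certificate. [folklore] -/
theorem root_mem_gates (t : PT X m) : t.root ∈ t.gates := by
  cases t <;> simp [root, gates]

/-- Satisfaction only depends on the variables of the certificate. [folklore] -/
theorem sat_congr {z z' : X → Bool} :
    ∀ {t : PT X m}, (∀ x ∈ t.pvars, z x = z' x) → (t.Sat z ↔ t.Sat z')
  | const _, _ => Iff.rfl
  | lit _ x b, h => by
      have hx : z x = z' x := h x (by simp [pvars])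
      simp [hx]
  | and _ l r, h => by
      simp only [pvars, List.mem_append] at h
      exact and_congr (sat_congr fun x hx => h x (Or.inl hx))
        (sat_congr fun x hx => h x (Or.inr hx))
  | orL _ t, h => sat_congr (t := t) h
  | orR _ t, h => sat_congr (t := t) h

end PT

/-- The children of an `∧`-gate come earlier. [cite: BovaCapelliMengelSlivovsky2016, §2] -/
theorem lt_of_node_and (C : NNFCircuit X m) {k i j : Fin m} (h : C.node k = .and i j) :
    i < k ∧ j < k :=
  ⟨C.lt_of_mem_children k i (by simp [h, Node.children]),
    C.lt_of_mem_children k j (by simp [h, Node.children])⟩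

/-- The children of an `∨`-gate come earlier. [cite: BovaCapelliMengelSlivovsky2016, §2] -/
theorem lt_of_node_or (C : NNFCircuit X m) {k i j : Fin m} (h : C.node k = .or i j) :
    i < k ∧ j < k :=
  ⟨C.lt_of_mem_children k i (by simp [h, Node.children]),
    C.lt_of_mem_children k j (by simp [h, Node.children])⟩

/-- `T ∈ cert(C)`: the certificate `T` follows the circuit `C` — its root is a gate of the
displayed kind, an `∧`-node carries certificates of both children, an `∨`-node a certificate of
the chosen child, leaves sit on literal gates or on `const true` gates (BCMS16 §3).
[cite: BovaCapelliMengelSlivovsky2016, §3 (p. 1010)] -/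
def Valid (C : NNFCircuit X m) : PT X m → Prop
  | .const k => C.node k = .const true
  | .lit k x b => C.node k = .lit x b
  | .and k l r => ∃ i j, C.node k = .and i j ∧ l.root = i ∧ r.root = j ∧ Valid C l ∧ Valid C r
  | .orL k t => ∃ i j, C.node k = .or i j ∧ t.root = i ∧ Valid C t
  | .orR k t => ∃ i j, C.node k = .or i j ∧ t.root = j ∧ Valid C t

section ValidLemmas

variable {C : NNFCircuit X m}

/-- Inversion: a valid certificate rooted at a constant gate. [folklore] -/
theorem Valid.const_inv {k : Fin m} {b : Bool} (hg : C.node k = .const b) :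
    ∀ {t : PT X m}, C.Valid t → t.root = k → b = true ∧ t = .const k
  | .const k', h, hr => by
      simp only [PT.root] at hr; subst hr; cases hg.symm.trans h; exact ⟨rfl, rfl⟩
  | .lit k' x b', h, hr => by
      simp only [PT.root] at hr; subst hr; cases hg.symm.trans h
  | .and k' l r, ⟨i', j', h, _⟩, hr => by
      simp only [PT.root] at hr; subst hr; cases hg.symm.trans h
  | .orL k' t, ⟨i', j', h, _⟩, hr => by
      simp only [PT.root] at hr; subst hr; cases hg.symm.trans h
  | .orR k' t, ⟨i', j', h, _⟩, hr => by
      simp only [PT.root] at hr; subst hr; cases hg.symm.trans h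

/-- Inversion: a valid certificate rooted at a literal gate. [folklore] -/
theorem Valid.lit_inv {k : Fin m} {x : X} {b : Bool} (hg : C.node k = .lit x b) :
    ∀ {t : PT X m}, C.Valid t → t.root = k → t = .lit k x b
  | .const k', h, hr => by
      simp only [PT.root] at hr; subst hr; cases hg.symm.trans h
  | .lit k' x' b', h, hr => by
      simp only [PT.root] at hr; subst hr; cases hg.symm.trans h; rfl
  | .and k' l r, ⟨i', j', h, _⟩, hr => by
      simp only [PT.root] at hr; subst hr; cases hg.symm.trans h
  | .orL k' t, ⟨i', j', h, _⟩, hr => by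
      simp only [PT.root] at hr; subst hr; cases hg.symm.trans h
  | .orR k' t, ⟨i', j', h, _⟩, hr => by
      simp only [PT.root] at hr; subst hr; cases hg.symm.trans h

/-- Inversion: a valid certificate rooted at an `∧`-gate. [folklore] -/
theorem Valid.and_inv {k i j : Fin m} (hg : C.node k = .and i j) :
    ∀ {t : PT X m}, C.Valid t → t.root = k →
      ∃ l r, t = .and k l r ∧ l.root = i ∧ r.root = j ∧ C.Valid l ∧ C.Valid r
  | .const k', h, hr => by
      simp only [PT.root] at hr; subst hr; cases hg.symm.trans h
  | .lit k' x' b', h, hr => by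
      simp only [PT.root] at hr; subst hr; cases hg.symm.trans h
  | .and k' l r, ⟨i', j', h, hl, hr', hvl, hvr⟩, hr => by
      simp only [PT.root] at hr; subst hr; cases hg.symm.trans h
      exact ⟨l, r, rfl, hl, hr', hvl, hvr⟩
  | .orL k' t, ⟨i', j', h, _⟩, hr => by
      simp only [PT.root] at hr; subst hr; cases hg.symm.trans h
  | .orR k' t, ⟨i', j', h, _⟩, hr => by
      simp only [PT.root] at hr; subst hr; cases hg.symm.trans h

/-- Inversion: a valid certificate rooted at an `∨`-gate. [folklore] -/
theorem Valid.or_inv {k i j : Fin m} (hg : C.node k = .or i j) :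
    ∀ {t : PT X m}, C.Valid t → t.root = k →
      (∃ s, t = .orL k s ∧ s.root = i ∧ C.Valid s) ∨ (∃ s, t = .orR k s ∧ s.root = j ∧ C.Valid s)
  | .const k', h, hr => by
      simp only [PT.root] at hr; subst hr; cases hg.symm.trans h
  | .lit k' x' b', h, hr => by
      simp only [PT.root] at hr; subst hr; cases hg.symm.trans h
  | .and k' l r, ⟨i', j', h, _⟩, hr => by
      simp only [PT.root] at hr; subst hr; cases hg.symm.trans h
  | .orL k' t, ⟨i', j', h, ht, hv⟩, hr => by
      simp only [PT.root] at hr; subst hr; cases hg.symm.trans h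
      exact Or.inl ⟨t, rfl, ht, hv⟩
  | .orR k' t, ⟨i', j', h, ht, hv⟩, hr => by
      simp only [PT.root] at hr; subst hr; cases hg.symm.trans h
      exact Or.inr ⟨t, rfl, ht, hv⟩

/-- **Satisfying assignments are exactly those with a certificate** (`sat(C_k) = ⋃_T sat(T)`,
BCMS16 eq. (2), at every gate). [cite: BovaCapelliMengelSlivovsky2016, §3 (eq. (2), p. 1010)] -/
theorem eval_eq_true_iff (C : NNFCircuit X m) (z : X → Bool) (k : Fin m) :
    C.eval z k = true ↔ ∃ t, C.Valid t ∧ t.root = k ∧ t.Sat z := by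
  suffices H : ∀ (n : ℕ) (k : Fin m), k.val = n →
      (C.eval z k = true ↔ ∃ t, C.Valid t ∧ t.root = k ∧ t.Sat z) from H _ k rfl
  intro n
  induction n using Nat.strong_induction_on with
  | _ n ih =>
    rintro k rfl
    rcases hg : C.node k with b | ⟨x, b⟩ | ⟨i, j⟩ | ⟨i, j⟩
    · rw [eval_of_const hg]
      constructor
      · rintro rfl
        exact ⟨.const k, hg, rfl, trivial⟩
      · rintro ⟨t, ht, hr, -⟩
        exact (Valid.const_inv hg ht hr).1
    · rw [eval_of_lit hg]
      constructor
      · intro h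
        exact ⟨.lit k x b, hg, rfl, by simpa using h⟩
      · rintro ⟨t, ht, hr, hs⟩
        obtain rfl := Valid.lit_inv hg ht hr
        simpa using hs
    · obtain ⟨hi, hj⟩ := C.lt_of_node_and hg
      rw [eval_of_and hg, Bool.and_eq_true, ih i.val hi i rfl, ih j.val hj j rfl]
      constructor
      · rintro ⟨⟨l, hl, hlr, hls⟩, ⟨r, hr, hrr, hrs⟩⟩
        exact ⟨.and k l r, ⟨i, j, hg, hlr, hrr, hl, hr⟩, rfl, hls, hrs⟩
      · rintro ⟨t, ht, hr, hs⟩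
        obtain ⟨l, r, rfl, hlr, hrr, hl, hr'⟩ := Valid.and_inv hg ht hr
        exact ⟨⟨l, hl, hlr, hs.1⟩, ⟨r, hr', hrr, hs.2⟩⟩
    · obtain ⟨hi, hj⟩ := C.lt_of_node_or hg
      rw [eval_of_or hg, Bool.or_eq_true, ih i.val hi i rfl, ih j.val hj j rfl]
      constructor
      · rintro (⟨s, hs, hsr, hss⟩ | ⟨s, hs, hsr, hss⟩)
        · exact ⟨.orL k s, ⟨i, j, hg, hsr, hs⟩, rfl, hss⟩
        · exact ⟨.orR k s, ⟨i, j, hg, hsr, hs⟩, rfl, hss⟩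
      · rintro ⟨t, ht, hr, hs⟩
        rcases Valid.or_inv hg ht hr with ⟨s, rfl, hsr, hv⟩ | ⟨s, rfl, hsr, hv⟩
        · exact Or.inl ⟨s, hv, hsr, hs⟩
        · exact Or.inr ⟨s, hv, hsr, hs⟩

/-- The leaves of a valid certificate carry variables of the subcircuit at its root
(`var(T_g) ⊆ var(C_g)`). [cite: BovaCapelliMengelSlivovsky2016, §3 (p. 1010)] -/
theorem Valid.pvars_subset [DecidableEq X] :
    ∀ {t : PT X m}, C.Valid t → ∀ x ∈ t.pvars, x ∈ C.vars t.root
  | .const k, _, x, hx => by simp [PT.pvars] at hx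
  | .lit k x b, hg, w, hw => by
      simp only [PT.pvars, List.mem_singleton] at hw
      subst hw
      simp only [PT.root]
      rw [vars_of_lit hg]
      exact Finset.mem_singleton_self _
  | .and k l r, ⟨i, j, hg, hl, hr, hvl, hvr⟩, w, hw => by
      simp only [PT.root]
      rw [vars_of_and hg, Finset.mem_union]
      simp only [PT.pvars, List.mem_append] at hw
      rcases hw with hw | hw
      · exact Or.inl (hl ▸ Valid.pvars_subset hvl w hw)
      · exact Or.inr (hr ▸ Valid.pvars_subset hvr w hw)
  | .orL k t, ⟨i, j, hg, ht, hv⟩, w, hw => by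
      simp only [PT.root]
      rw [vars_of_or hg, Finset.mem_union]
      exact Or.inl (ht ▸ Valid.pvars_subset hv w hw)
  | .orR k t, ⟨i, j, hg, ht, hv⟩, w, hw => by
      simp only [PT.root]
      rw [vars_of_or hg, Finset.mem_union]
      exact Or.inr (ht ▸ Valid.pvars_subset hv w hw)

/-- **Determinism makes certificates unique**: in a deterministic NNF an assignment satisfies at
most one certificate of each gate (the content of BCMS16 Lemma 5).
[cite: BovaCapelliMengelSlivovsky2016, Lemma 5 (p. 1011)] -/
theorem Valid.eq_of_sat (hC : C.IsDeterministic) {z : X → Bool} :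
    ∀ {t t' : PT X m}, C.Valid t → C.Valid t' → t.root = t'.root → t.Sat z → t'.Sat z → t = t'
  | .const k, t', hg, ht', hr, _, _ => ((Valid.const_inv hg ht' hr.symm).2).symm
  | .lit k x b, t', hg, ht', hr, _, _ => (Valid.lit_inv hg ht' hr.symm).symm
  | .and k l r, t', ⟨i, j, hg, hl, hr', hvl, hvr⟩, ht', hr, hs, hs' => by
      obtain ⟨l', r', rfl, hl', hr'', hvl', hvr'⟩ := Valid.and_inv hg ht' hr.symm
      simp only [PT.sat_and] at hs hs'
      rw [Valid.eq_of_sat hC hvl hvl' (hl.trans hl'.symm) hs.1 hs'.1,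
        Valid.eq_of_sat hC hvr hvr' (hr'.trans hr''.symm) hs.2 hs'.2]
  | .orL k s, t', ⟨i, j, hg, hsr, hv⟩, ht', hr, hs, hs' => by
      rcases Valid.or_inv hg ht' hr.symm with ⟨s', rfl, hsr', hv'⟩ | ⟨s', rfl, hsr', hv'⟩
      · simp only [PT.sat_orL] at hs hs'
        rw [Valid.eq_of_sat hC hv hv' (hsr.trans hsr'.symm) hs hs']
      · simp only [PT.sat_orL, PT.sat_orR] at hs hs'
        have h1 : z ∈ C.sat i := (C.eval_eq_true_iff z i).2 ⟨s, hv, hsr, hs⟩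
        have h2 : z ∈ C.sat j := (C.eval_eq_true_iff z j).2 ⟨s', hv', hsr', hs'⟩
        exact absurd h2 (Set.disjoint_left.1 (hC k i j hg) h1)
  | .orR k s, t', ⟨i, j, hg, hsr, hv⟩, ht', hr, hs, hs' => by
      rcases Valid.or_inv hg ht' hr.symm with ⟨s', rfl, hsr', hv'⟩ | ⟨s', rfl, hsr', hv'⟩
      · simp only [PT.sat_orL, PT.sat_orR] at hs hs'
        have h1 : z ∈ C.sat i := (C.eval_eq_true_iff z i).2 ⟨s', hv', hsr', hs'⟩
        have h2 : z ∈ C.sat j := (C.eval_eq_true_iff z j).2 ⟨s, hv, hsr, hs⟩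
        exact absurd h2 (Set.disjoint_left.1 (hC k i j hg) h1)
      · simp only [PT.sat_orR] at hs hs'
        rw [Valid.eq_of_sat hC hv hv' (hsr.trans hsr'.symm) hs hs']

end ValidLemmas

/-! #### One-hole contexts -/

/-- A certificate with a hole in place of one sub-certificate: the path from the root to the
hole together with the off-path sub-certificates (at `∧`-nodes). Plugging a certificate of the
hole's gate gives a certificate (`Ctx.plug`); this is the "replace `T_g` by `T'_g`" operation of
BCMS16 (proofs of Lemma 2 and Theorem 1). [cite: BovaCapelliMengelSlivovsky2016, §3 (p. 1011)] -/
inductive Ctx (X : Type*) (m : ℕ) : Type _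
  /-- the hole -/
  | hole
  /-- `∧`-gate `k`, hole in the first child, certificate `r` of the second child -/
  | andL (k : Fin m) (K : Ctx X m) (r : PT X m)
  /-- `∧`-gate `k`, certificate `l` of the first child, hole in the second child -/
  | andR (k : Fin m) (l : PT X m) (K : Ctx X m)
  /-- `∨`-gate `k` choosing its first child, hole below it -/
  | orL (k : Fin m) (K : Ctx X m)
  /-- `∨`-gate `k` choosing its second child, hole below it -/
  | orR (k : Fin m) (K : Ctx X m)

namespace Ctx

/-- Plug a certificate into the hole. [cite: BovaCapelliMengelSlivovsky2016, §3 (p. 1011)] -/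
def plug : Ctx X m → PT X m → PT X m
  | hole, t => t
  | andL k K r, t => .and k (K.plug t) r
  | andR k l K, t => .and k l (K.plug t)
  | orL k K, t => .orL k (K.plug t)
  | orR k K, t => .orR k (K.plug t)

/-- Gates occurring in a context (path nodes and off-path certificates). [folklore] -/
def cgates : Ctx X m → List (Fin m)
  | hole => []
  | andL k K r => k :: (K.cgates ++ r.gates)
  | andR k l K => k :: (l.gates ++ K.cgates)
  | orL k K => k :: K.cgates
  | orR k K => k :: K.cgates

/-- Variables of the off-path certificates of a context (`var(T ∖ T_g)`). [folklore] -/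
def cvars : Ctx X m → List X
  | hole => []
  | andL _ K r => K.cvars ++ r.pvars
  | andR _ l K => l.pvars ++ K.cvars
  | orL _ K => K.cvars
  | orR _ K => K.cvars

/-- The assignment satisfies all literals of the off-path certificates. [folklore] -/
def CSat (z : X → Bool) : Ctx X m → Prop
  | hole => True
  | andL _ K r => CSat z K ∧ r.Sat z
  | andR _ l K => l.Sat z ∧ CSat z K
  | orL _ K => CSat z K
  | orR _ K => CSat z K

/-- The context avoids the set `F` of (eliminated) gates. [folklore] -/
def CAvoids (F : Finset (Fin m)) (K : Ctx X m) : Prop := ∀ g ∈ K.cgates, g ∉ F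

/-- Gates of a plugged certificate. [folklore] -/
theorem mem_gates_plug {g : Fin m} :
    ∀ {K : Ctx X m} {t : PT X m}, g ∈ (K.plug t).gates ↔ g ∈ K.cgates ∨ g ∈ t.gates
  | hole, t => by simp [plug, cgates]
  | andL k K r, t => by
      simp only [plug, PT.gates, List.mem_cons, List.mem_append, cgates, mem_gates_plug (K := K)]
      tauto
  | andR k l K, t => by
      simp only [plug, PT.gates, List.mem_cons, List.mem_append, cgates, mem_gates_plug (K := K)]
      tauto
  | orL k K, t => by
      simp only [plug, PT.gates, List.mem_cons, cgates, mem_gates_plug (K := K)]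
      tauto
  | orR k K, t => by
      simp only [plug, PT.gates, List.mem_cons, cgates, mem_gates_plug (K := K)]
      tauto

/-- Variables of a plugged certificate. [folklore] -/
theorem mem_pvars_plug {x : X} :
    ∀ {K : Ctx X m} {t : PT X m}, x ∈ (K.plug t).pvars ↔ x ∈ K.cvars ∨ x ∈ t.pvars
  | hole, t => by simp [plug, cvars]
  | andL k K r, t => by
      simp only [plug, PT.pvars, List.mem_append, cvars, mem_pvars_plug (K := K)]
      tauto
  | andR k l K, t => by
      simp only [plug, PT.pvars, List.mem_append, cvars, mem_pvars_plug (K := K)]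
      tauto
  | orL k K, t => by simp only [plug, PT.pvars, cvars, mem_pvars_plug (K := K)]
  | orR k K, t => by simp only [plug, PT.pvars, cvars, mem_pvars_plug (K := K)]

/-- Satisfaction of a plugged certificate. [folklore] -/
theorem sat_plug {z : X → Bool} :
    ∀ {K : Ctx X m} {t : PT X m}, (K.plug t).Sat z ↔ K.CSat z ∧ t.Sat z
  | hole, t => by simp [plug, CSat]
  | andL k K r, t => by simp only [plug, PT.sat_and, CSat, sat_plug (K := K)]; tauto
  | andR k l K, t => by simp only [plug, PT.sat_and, CSat, sat_plug (K := K)]; tauto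
  | orL k K, t => by simp only [plug, PT.sat_orL, CSat, sat_plug (K := K)]
  | orR k K, t => by simp only [plug, PT.sat_orR, CSat, sat_plug (K := K)]

/-- Avoidance of a plugged certificate. [folklore] -/
theorem avoids_plug {F : Finset (Fin m)} {K : Ctx X m} {t : PT X m} :
    (K.plug t).Avoids F ↔ K.CAvoids F ∧ t.Avoids F := by
  simp only [PT.Avoids, mem_gates_plug, CAvoids]
  exact ⟨fun h => ⟨fun g hg => h g (Or.inl hg), fun g hg => h g (Or.inr hg)⟩,
    fun h g hg => hg.elim (h.1 g) (h.2 g)⟩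

/-- The root of a plugged certificate only depends on the root of the plug. [folklore] -/
theorem root_plug_eq : ∀ (K : Ctx X m) {t t' : PT X m}, t.root = t'.root →
    (K.plug t).root = (K.plug t').root
  | hole, _, _, h => h
  | andL _ _ _, _, _, _ => rfl
  | andR _ _ _, _, _, _ => rfl
  | orL _ _, _, _, _ => rfl
  | orR _ _, _, _, _ => rfl

/-- Context satisfaction only depends on the context's variables. [folklore] -/
theorem csat_congr {z z' : X → Bool} :
    ∀ {K : Ctx X m}, (∀ x ∈ K.cvars, z x = z' x) → (K.CSat z ↔ K.CSat z')
  | hole, _ => Iff.rfl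
  | andL _ K r, h => by
      simp only [cvars, List.mem_append] at h
      exact and_congr (csat_congr fun x hx => h x (Or.inl hx))
        (PT.sat_congr fun x hx => h x (Or.inr hx))
  | andR _ l K, h => by
      simp only [cvars, List.mem_append] at h
      exact and_congr (PT.sat_congr fun x hx => h x (Or.inl hx))
        (csat_congr fun x hx => h x (Or.inr hx))
  | orL _ K, h => csat_congr (K := K) h
  | orR _ K, h => csat_congr (K := K) h

end Ctx

/-- Every occurrence of a gate in a certificate splits it as context ∘ sub-certificate.
[folklore] -/
theorem PT.exists_eq_plug {g : Fin m} :
    ∀ {t : PT X m}, g ∈ t.gates → ∃ (K : Ctx X m) (s : PT X m), t = K.plug s ∧ s.root = g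
  | .const k, h => by
      simp only [PT.gates, List.mem_singleton] at h
      exact ⟨.hole, .const k, rfl, h.symm⟩
  | .lit k x b, h => by
      simp only [PT.gates, List.mem_singleton] at h
      exact ⟨.hole, .lit k x b, rfl, h.symm⟩
  | .and k l r, h => by
      simp only [PT.gates, List.mem_cons, List.mem_append] at h
      rcases h with h | h | h
      · exact ⟨.hole, .and k l r, rfl, h.symm⟩
      · obtain ⟨K, s, rfl, hs⟩ := PT.exists_eq_plug h
        exact ⟨.andL k K r, s, rfl, hs⟩
      · obtain ⟨K, s, rfl, hs⟩ := PT.exists_eq_plug h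
        exact ⟨.andR k l K, s, rfl, hs⟩
  | .orL k t, h => by
      simp only [PT.gates, List.mem_cons] at h
      rcases h with h | h
      · exact ⟨.hole, .orL k t, rfl, h.symm⟩
      · obtain ⟨K, s, rfl, hs⟩ := PT.exists_eq_plug h
        exact ⟨.orL k K, s, rfl, hs⟩
  | .orR k t, h => by
      simp only [PT.gates, List.mem_cons] at h
      rcases h with h | h
      · exact ⟨.hole, .orR k t, rfl, h.symm⟩
      · obtain ⟨K, s, rfl, hs⟩ := PT.exists_eq_plug h
        exact ⟨.orR k K, s, rfl, hs⟩

section PlugLemmas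

variable {C : NNFCircuit X m}

/-- The plug of a valid certificate is valid. [folklore] -/
theorem Valid.of_plug : ∀ {K : Ctx X m} {t : PT X m}, C.Valid (K.plug t) → C.Valid t
  | .hole, _, h => h
  | .andL _ K _, _, ⟨_, _, _, _, _, hv, _⟩ => Valid.of_plug (K := K) hv
  | .andR _ _ K, _, ⟨_, _, _, _, _, _, hv⟩ => Valid.of_plug (K := K) hv
  | .orL _ K, _, ⟨_, _, _, _, hv⟩ => Valid.of_plug (K := K) hv
  | .orR _ K, _, ⟨_, _, _, _, hv⟩ => Valid.of_plug (K := K) hv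

/-- **Exchange**: replacing the plugged certificate by any valid certificate of the same gate keeps
validity (BCMS16, proof of Theorem 1: "by replacing `T'_g` in `T'` by `T_g` we obtain a
certificate"). [cite: BovaCapelliMengelSlivovsky2016, §3 (proof of Thm. 1, p. 1011)] -/
theorem Valid.plug_congr : ∀ {K : Ctx X m} {t t' : PT X m}, C.Valid (K.plug t) → C.Valid t' →
    t'.root = t.root → C.Valid (K.plug t')
  | .hole, _, _, _, h', _ => h'
  | .andL _ K _, _, _, ⟨i, j, hg, hl, hr, hvl, hvr⟩, h', he =>
      ⟨i, j, hg, (Ctx.root_plug_eq K he).trans hl, hr, Valid.plug_congr hvl h' he, hvr⟩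
  | .andR _ _ K, _, _, ⟨i, j, hg, hl, hr, hvl, hvr⟩, h', he =>
      ⟨i, j, hg, hl, (Ctx.root_plug_eq K he).trans hr, hvl, Valid.plug_congr hvr h' he⟩
  | .orL _ K, _, _, ⟨i, j, hg, hs, hv⟩, h', he =>
      ⟨i, j, hg, (Ctx.root_plug_eq K he).trans hs, Valid.plug_congr hv h' he⟩
  | .orR _ K, _, _, ⟨i, j, hg, hs, hv⟩, h', he =>
      ⟨i, j, hg, (Ctx.root_plug_eq K he).trans hs, Valid.plug_congr hv h' he⟩

/-- In a valid certificate the plugged gate lies strictly before the root of a nontrivial context.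
[folklore] -/
theorem Valid.root_lt_root_plug : ∀ {K : Ctx X m} {t : PT X m}, C.Valid (K.plug t) →
    K ≠ .hole → t.root < (K.plug t).root
  | .hole, _, _, h => (h rfl).elim
  | .andL k K r, t, ⟨i, j, hg, hl, _, hvl, _⟩, _ => by
      show t.root < k
      have hi : i < k := (C.lt_of_node_and hg).1
      by_cases hK : K = .hole
      · subst hK; simp only [Ctx.plug] at hl; rw [hl]; exact hi
      · exact lt_trans (Valid.root_lt_root_plug hvl hK) (hl ▸ hi)
  | .andR k l K, t, ⟨i, j, hg, _, hr, _, hvr⟩, _ => by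
      show t.root < k
      have hj : j < k := (C.lt_of_node_and hg).2
      by_cases hK : K = .hole
      · subst hK; simp only [Ctx.plug] at hr; rw [hr]; exact hj
      · exact lt_trans (Valid.root_lt_root_plug hvr hK) (hr ▸ hj)
  | .orL k K, t, ⟨i, j, hg, hs, hv⟩, _ => by
      show t.root < k
      have hi : i < k := (C.lt_of_node_or hg).1
      by_cases hK : K = .hole
      · subst hK; simp only [Ctx.plug] at hs; rw [hs]; exact hi
      · exact lt_trans (Valid.root_lt_root_plug hv hK) (hs ▸ hi)
  | .orR k K, t, ⟨i, j, hg, hs, hv⟩, _ => by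
      show t.root < k
      have hj : j < k := (C.lt_of_node_or hg).2
      by_cases hK : K = .hole
      · subst hK; simp only [Ctx.plug] at hs; rw [hs]; exact hj
      · exact lt_trans (Valid.root_lt_root_plug hv hK) (hs ▸ hj)

/-- **Decomposability separates a context from its plugs** (BCMS16 Lemma 2,
`var(T ∖ T_g) ⊆ var(C) ∖ var(C_g)`): a variable of the off-path part of a valid context to gate
`g` occurs in no valid certificate of `g`. [cite: BovaCapelliMengelSlivovsky2016, Lemma 2 (p. 1010)] -/
theorem Valid.cvars_disjoint [DecidableEq X] (hC : C.IsDecomposable) :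
    ∀ {K : Ctx X m} {t : PT X m}, C.Valid (K.plug t) →
      ∀ x ∈ K.cvars, ∀ {s : PT X m}, C.Valid s → s.root = t.root → x ∉ s.pvars
  | .hole, _, _, x, hx, _, _, _ => by simp [Ctx.cvars] at hx
  | .andL k K r, t, ⟨i, j, hg, hl, hr, hvl, hvr⟩, x, hx, s, hs, he => by
      simp only [Ctx.cvars, List.mem_append] at hx
      rcases hx with hx | hx
      · exact Valid.cvars_disjoint hC hvl x hx hs he
      · intro hxs
        have hps : C.Valid (K.plug s) := Valid.plug_congr hvl hs he
        have hrs : (K.plug s).root = i := (Ctx.root_plug_eq K he).trans hl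
        have h1 : x ∈ C.vars i :=
          hrs ▸ Valid.pvars_subset hps x (Ctx.mem_pvars_plug.2 (Or.inr hxs))
        have h2 : x ∈ C.vars j := hr ▸ Valid.pvars_subset hvr x hx
        exact Finset.disjoint_left.1 (hC k i j hg) h1 h2
  | .andR k l K, t, ⟨i, j, hg, hl, hr, hvl, hvr⟩, x, hx, s, hs, he => by
      simp only [Ctx.cvars, List.mem_append] at hx
      rcases hx with hx | hx
      · intro hxs
        have hps : C.Valid (K.plug s) := Valid.plug_congr hvr hs he
        have hrs : (K.plug s).root = j := (Ctx.root_plug_eq K he).trans hr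
        have h1 : x ∈ C.vars j :=
          hrs ▸ Valid.pvars_subset hps x (Ctx.mem_pvars_plug.2 (Or.inr hxs))
        have h2 : x ∈ C.vars i := hl ▸ Valid.pvars_subset hvl x hx
        exact Finset.disjoint_left.1 (hC k i j hg) h2 h1
      · exact Valid.cvars_disjoint hC hvr x hx hs he
  | .orL k K, t, ⟨i, j, hg, hsr, hv'⟩, x, hx, s, hs, he =>
      Valid.cvars_disjoint hC hv' x hx hs he
  | .orR k K, t, ⟨i, j, hg, hsr, hv'⟩, x, hx, s, hs, he =>
      Valid.cvars_disjoint hC hv' x hx hs he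

end PlugLemmas

/-! #### Certificates avoiding a set of eliminated gates -/

section Avoiding

/-- Some certificate of gate `i` avoids `F` (decidable recursive form of
`cert(C_i) ∖ ⋃_{g ∈ F} cert(C_i, g) ≠ ∅`). [cite: BovaCapelliMengelSlivovsky2016, §3 (Prop. 3, p. 1011)] -/
def alive (C : NNFCircuit X m) (F : Finset (Fin m)) (i : Fin m) : Bool :=
  decide (i ∉ F) &&
    match h : C.node i with
    | .const b => b
    | .lit _ _ => true
    | .and h₁ h₂ =>
      have : h₁ < i := C.lt_of_mem_children i h₁ (by simp [h, Node.children])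
      have : h₂ < i := C.lt_of_mem_children i h₂ (by simp [h, Node.children])
      C.alive F h₁ && C.alive F h₂
    | .or h₁ h₂ =>
      have : h₁ < i := C.lt_of_mem_children i h₁ (by simp [h, Node.children])
      have : h₂ < i := C.lt_of_mem_children i h₂ (by simp [h, Node.children])
      C.alive F h₁ || C.alive F h₂
termination_by i

variable {C : NNFCircuit X m} {F : Finset (Fin m)}

/-- `alive` at a literal gate. [folklore] -/
theorem alive_of_lit {k : Fin m} {x : X} {b : Bool} (h : C.node k = .lit x b) :
    C.alive F k = decide (k ∉ F) := by
  rw [alive]; split <;> simp_all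

/-- `alive` at a constant gate. [folklore] -/
theorem alive_of_const {k : Fin m} {b : Bool} (h : C.node k = .const b) :
    C.alive F k = (decide (k ∉ F) && b) := by
  rw [alive]; split <;> simp_all

/-- `alive` at an `∧`-gate: both children alive. [folklore] -/
theorem alive_of_and {k i j : Fin m} (h : C.node k = .and i j) :
    C.alive F k = (decide (k ∉ F) && (C.alive F i && C.alive F j)) := by
  rw [alive]; split <;> simp_all

/-- `alive` at an `∨`-gate: some child alive. [folklore] -/
theorem alive_of_or {k i j : Fin m} (h : C.node k = .or i j) :
    C.alive F k = (decide (k ∉ F) && (C.alive F i || C.alive F j)) := by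
  rw [alive]; split <;> simp_all

/-- `alive` gates are not eliminated. [folklore] -/
theorem not_mem_of_alive {k : Fin m} (h : C.alive F k = true) : k ∉ F := by
  rw [alive, Bool.and_eq_true, decide_eq_true_eq] at h
  exact h.1

/-- An `F`-avoiding valid certificate makes its root `alive`.
[cite: BovaCapelliMengelSlivovsky2016, §3 (Prop. 3, p. 1011)] -/
theorem Valid.alive_of_avoids :
    ∀ {t : PT X m}, C.Valid t → t.Avoids F → C.alive F t.root = true
  | .const k, hg, hA => by
      have hk : k ∉ F := hA k (by simp [PT.gates])
      simp only [PT.root]; rw [alive_of_const hg]; simp [hk]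
  | .lit k x b, hg, hA => by
      have hk : k ∉ F := hA k (by simp [PT.gates])
      simp only [PT.root]; rw [alive_of_lit hg]; simp [hk]
  | .and k l r, ⟨i, j, hg, hl, hr, hvl, hvr⟩, hA => by
      have hk : k ∉ F := hA k (by simp [PT.gates])
      have hAl : l.Avoids F := fun g hg' => hA g (by simp [PT.gates, hg'])
      have hAr : r.Avoids F := fun g hg' => hA g (by simp [PT.gates, hg'])
      simp only [PT.root]
      rw [alive_of_and hg, ← hl, ← hr, Valid.alive_of_avoids hvl hAl,
        Valid.alive_of_avoids hvr hAr]
      simp [hk]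
  | .orL k t, ⟨i, j, hg, ht, hv⟩, hA => by
      have hk : k ∉ F := hA k (by simp [PT.gates])
      have hAt : t.Avoids F := fun g hg' => hA g (by simp [PT.gates, hg'])
      simp only [PT.root]
      rw [alive_of_or hg, ← ht, Valid.alive_of_avoids hv hAt]
      simp [hk]
  | .orR k t, ⟨i, j, hg, ht, hv⟩, hA => by
      have hk : k ∉ F := hA k (by simp [PT.gates])
      have hAt : t.Avoids F := fun g hg' => hA g (by simp [PT.gates, hg'])
      simp only [PT.root]
      rw [alive_of_or hg, ← ht, Valid.alive_of_avoids hv hAt]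
      simp [hk]

/-- An `alive` gate has an `F`-avoiding valid certificate.
[cite: BovaCapelliMengelSlivovsky2016, §3 (Prop. 3, p. 1011)] -/
theorem exists_valid_of_alive :
    ∀ (k : Fin m), C.alive F k = true → ∃ t, C.Valid t ∧ t.Avoids F ∧ t.root = k := by
  suffices H : ∀ (n : ℕ) (k : Fin m), k.val = n → C.alive F k = true →
      ∃ t, C.Valid t ∧ t.Avoids F ∧ t.root = k from fun k => H _ k rfl
  intro n
  induction n using Nat.strong_induction_on with
  | _ n ih =>
    rintro k rfl h
    have hk : k ∉ F := not_mem_of_alive h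
    rcases hg : C.node k with b | ⟨x, b⟩ | ⟨i, j⟩ | ⟨i, j⟩
    · rw [alive_of_const hg] at h
      have hb : b = true := by simpa [hk] using h
      subst hb
      exact ⟨.const k, hg, fun g hg' => by simp [PT.gates] at hg'; exact hg' ▸ hk, rfl⟩
    · exact ⟨.lit k x b, hg, fun g hg' => by simp [PT.gates] at hg'; exact hg' ▸ hk, rfl⟩
    · rw [alive_of_and hg] at h
      obtain ⟨hi, hj⟩ := C.lt_of_node_and hg
      have h' : C.alive F i = true ∧ C.alive F j = true := by simpa [hk] using h
      obtain ⟨l, hl, hAl, hlr⟩ := ih i.val hi i rfl h'.1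
      obtain ⟨r, hr, hAr, hrr⟩ := ih j.val hj j rfl h'.2
      refine ⟨.and k l r, ⟨i, j, hg, hlr, hrr, hl, hr⟩, ?_, rfl⟩
      intro g hg'
      simp only [PT.gates, List.mem_cons, List.mem_append] at hg'
      rcases hg' with rfl | hg' | hg'
      exacts [hk, hAl g hg', hAr g hg']
    · rw [alive_of_or hg] at h
      obtain ⟨hi, hj⟩ := C.lt_of_node_or hg
      have h' : C.alive F i = true ∨ C.alive F j = true := by simpa [hk] using h
      rcases h' with h' | h'
      · obtain ⟨s, hs, hAs, hsr⟩ := ih i.val hi i rfl h'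
        refine ⟨.orL k s, ⟨i, j, hg, hsr, hs⟩, ?_, rfl⟩
        intro g hg'
        simp only [PT.gates, List.mem_cons] at hg'
        rcases hg' with rfl | hg'
        exacts [hk, hAs g hg']
      · obtain ⟨s, hs, hAs, hsr⟩ := ih j.val hj j rfl h'
        refine ⟨.orR k s, ⟨i, j, hg, hsr, hs⟩, ?_, rfl⟩
        intro g hg'
        simp only [PT.gates, List.mem_cons] at hg'
        rcases hg' with rfl | hg'
        exacts [hk, hAs g hg']

/-- The rectangle attached to gate `g` after eliminating the gates in `F`
(`sat(C − F, g)` of BCMS16): assignments satisfying an `F`-avoiding certificate of `g` AND an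
`F`-avoiding context from the output to `g`. [cite: BovaCapelliMengelSlivovsky2016, §3 (eq. (3), p. 1010)] -/
def gateRect (C : NNFCircuit X m) (F : Finset (Fin m)) (g : Fin m) : Set (X → Bool) :=
  {z | ∃ t, C.Valid t ∧ t.Avoids F ∧ t.root = g ∧ t.Sat z} ∩
    {z | ∃ (K : Ctx X m) (s : PT X m), C.Valid (K.plug s) ∧ K.CAvoids F ∧ s.root = g ∧
      (K.plug s).root = C.out ∧ K.CSat z}

/-- `sat(C − F, g) ⊆ sat(C)` (BCMS16 Lemma 4, right inclusion).
[cite: BovaCapelliMengelSlivovsky2016, Lemma 4 (p. 1011)] -/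
theorem gateRect_subset_sat (C : NNFCircuit X m) (F : Finset (Fin m)) (g : Fin m) :
    C.gateRect F g ⊆ C.sat C.out := by
  rintro z ⟨⟨t, ht, -, htr, hts⟩, ⟨K, s, hKs, -, hsr, hout, hKz⟩⟩
  have he : t.root = s.root := htr.trans hsr.symm
  refine (C.eval_eq_true_iff z C.out).2 ⟨K.plug t, Valid.plug_congr hKs ht he, ?_, ?_⟩
  · rw [Ctx.root_plug_eq K he]; exact hout
  · exact Ctx.sat_plug.2 ⟨hKz, hts⟩

/-- An `F`-avoiding certificate of the output through `g` lands in `sat(C − F, g)`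
(BCMS16 Lemma 4, left inclusion). [cite: BovaCapelliMengelSlivovsky2016, Lemma 4 (p. 1011)] -/
theorem mem_gateRect_of_mem_gates {z : X → Bool} {T : PT X m} (hT : C.Valid T)
    (hA : T.Avoids F) (hr : T.root = C.out) (hs : T.Sat z) {g : Fin m} (hg : g ∈ T.gates) :
    z ∈ C.gateRect F g := by
  obtain ⟨K, s, rfl, hsr⟩ := PT.exists_eq_plug hg
  obtain ⟨hKA, hsA⟩ := Ctx.avoids_plug.1 hA
  obtain ⟨hKs, hss⟩ := Ctx.sat_plug.1 hs
  exact ⟨⟨s, Valid.of_plug hT, hsA, hsr, hss⟩, ⟨K, s, hT, hKA, hsr, hr, hKs⟩⟩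

/-- **Disjointness under determinism**: rectangles attached in different rounds are disjoint
(BCMS16 Lemma 5: `sat(C^i, g_i) ∩ sat(C^{i+1}) = ∅`).
[cite: BovaCapelliMengelSlivovsky2016, Lemma 5 (p. 1011)] -/
theorem gateRect_disjoint (hD : C.IsDeterministic) {F F' : Finset (Fin m)} {g g' : Fin m}
    (h : g ∈ F') : Disjoint (C.gateRect F g) (C.gateRect F' g') := by
  refine Set.disjoint_left.2 ?_
  rintro z ⟨⟨t, ht, -, htr, hts⟩, ⟨K, s, hKs, -, hsr, hout, hKz⟩⟩
    ⟨⟨t', ht', ht'A, ht'r, ht's⟩, ⟨K', s', hK's', hK'A, hs'r, hout', hK'z⟩⟩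
  have he : t.root = s.root := htr.trans hsr.symm
  have he' : t'.root = s'.root := ht'r.trans hs'r.symm
  have hv : C.Valid (K.plug t) := Valid.plug_congr hKs ht he
  have hv' : C.Valid (K'.plug t') := Valid.plug_congr hK's' ht' he'
  have hroot : (K.plug t).root = (K'.plug t').root := by
    rw [Ctx.root_plug_eq K he, hout, Ctx.root_plug_eq K' he', hout']
  have heq : K.plug t = K'.plug t' :=
    Valid.eq_of_sat hD hv hv' hroot (Ctx.sat_plug.2 ⟨hKz, hts⟩) (Ctx.sat_plug.2 ⟨hK'z, ht's⟩)
  have hgt : g ∈ (K.plug t).gates := Ctx.mem_gates_plug.2 (Or.inr (htr ▸ t.root_mem_gates))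
  rw [heq] at hgt
  have hA' : (K'.plug t').Avoids F' := Ctx.avoids_plug.2 ⟨hK'A, ht'A⟩
  exact hA' g hgt h

end Avoiding

/-! #### The variables of the surviving certificates, and the descent -/

section Descent

variable [DecidableEq X]

/-- `var((C − F)_i)`: the variables of the `F`-avoiding certificates of gate `i` (recursive
form; `∅` when no certificate of `i` avoids `F`).
[cite: BovaCapelliMengelSlivovsky2016, §3 (proof of Thm. 6, p. 1012)] -/
def VF (C : NNFCircuit X m) (F : Finset (Fin m)) (i : Fin m) : Finset X :=
  if C.alive F i then
    match h : C.node i with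
    | .const _ => ∅
    | .lit x _ => {x}
    | .and h₁ h₂ =>
      have : h₁ < i := C.lt_of_mem_children i h₁ (by simp [h, Node.children])
      have : h₂ < i := C.lt_of_mem_children i h₂ (by simp [h, Node.children])
      C.VF F h₁ ∪ C.VF F h₂
    | .or h₁ h₂ =>
      have : h₁ < i := C.lt_of_mem_children i h₁ (by simp [h, Node.children])
      have : h₂ < i := C.lt_of_mem_children i h₂ (by simp [h, Node.children])
      C.VF F h₁ ∪ C.VF F h₂
  else ∅
termination_by i

variable {C : NNFCircuit X m} {F : Finset (Fin m)}

/-- No surviving certificate, no surviving variables. [folklore] -/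
theorem VF_of_not_alive {k : Fin m} (h : C.alive F k = false) : C.VF F k = ∅ := by
  rw [VF]; simp [h]

/-- Surviving variables witness a surviving certificate. [folklore] -/
theorem alive_of_VF_nonempty {k : Fin m} (h : (C.VF F k).Nonempty) : C.alive F k = true := by
  by_contra h'
  rw [Bool.not_eq_true] at h'
  rw [VF_of_not_alive h'] at h
  exact Finset.not_nonempty_empty h

/-- Surviving variables of a literal gate. [folklore] -/
theorem VF_of_lit {k : Fin m} {x : X} {b : Bool} (h : C.node k = .lit x b) :
    C.VF F k ⊆ {x} := by
  rw [VF]; split <;> (try split) <;> simp_all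

/-- Surviving variables of an alive literal gate. [folklore] -/
theorem VF_of_lit_of_alive {k : Fin m} {x : X} {b : Bool} (h : C.node k = .lit x b)
    (ha : C.alive F k = true) : C.VF F k = {x} := by
  rw [VF, if_pos ha]; split <;> simp_all

/-- A constant gate has no variables. [folklore] -/
theorem VF_of_const {k : Fin m} {b : Bool} (h : C.node k = .const b) : C.VF F k = ∅ := by
  rw [VF]; split <;> (try split) <;> simp_all

/-- Surviving variables of an `∧`-gate. [folklore] -/
theorem VF_of_and {k i j : Fin m} (h : C.node k = .and i j) :
    C.VF F k = if C.alive F k then C.VF F i ∪ C.VF F j else ∅ := by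
  rw [VF]; split <;> (try split) <;> simp_all

/-- Surviving variables of an `∨`-gate. [folklore] -/
theorem VF_of_or {k i j : Fin m} (h : C.node k = .or i j) :
    C.VF F k = if C.alive F k then C.VF F i ∪ C.VF F j else ∅ := by
  rw [VF]; split <;> (try split) <;> simp_all

/-- Surviving variables of an `∧`-gate come from its children. [folklore] -/
theorem VF_subset_union_of_and {k i j : Fin m} (h : C.node k = .and i j) :
    C.VF F k ⊆ C.VF F i ∪ C.VF F j := by
  rw [VF_of_and h]; split_ifs <;> simp

/-- Surviving variables of an `∨`-gate come from its children. [folklore] -/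
theorem VF_subset_union_of_or {k i j : Fin m} (h : C.node k = .or i j) :
    C.VF F k ⊆ C.VF F i ∪ C.VF F j := by
  rw [VF_of_or h]; split_ifs <;> simp

/-- The leaves of an `F`-avoiding valid certificate carry variables of `var((C − F)_k)`.
[cite: BovaCapelliMengelSlivovsky2016, §3 (Thm. 1 for `C − F`, p. 1011)] -/
theorem Valid.pvars_subset_VF :
    ∀ {t : PT X m}, C.Valid t → t.Avoids F → ∀ x ∈ t.pvars, x ∈ C.VF F t.root
  | .const k, _, _, x, hx => by simp [PT.pvars] at hx
  | .lit k x b, hg, hA, w, hw => by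
      have ha := Valid.alive_of_avoids (t := .lit k x b) hg hA
      simp only [PT.root] at ha ⊢
      simp only [PT.pvars, List.mem_singleton] at hw
      rw [VF_of_lit_of_alive hg ha, hw]
      exact Finset.mem_singleton_self _
  | .and k l r, ⟨i, j, hg, hl, hr, hvl, hvr⟩, hA, w, hw => by
      have ha := Valid.alive_of_avoids (t := .and k l r) ⟨i, j, hg, hl, hr, hvl, hvr⟩ hA
      have hAl : l.Avoids F := fun g hg' => hA g (by simp [PT.gates, hg'])
      have hAr : r.Avoids F := fun g hg' => hA g (by simp [PT.gates, hg'])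
      simp only [PT.root] at ha ⊢
      rw [VF_of_and hg, if_pos ha, Finset.mem_union]
      simp only [PT.pvars, List.mem_append] at hw
      rcases hw with hw | hw
      · exact Or.inl (hl ▸ Valid.pvars_subset_VF hvl hAl w hw)
      · exact Or.inr (hr ▸ Valid.pvars_subset_VF hvr hAr w hw)
  | .orL k t, ⟨i, j, hg, ht, hv⟩, hA, w, hw => by
      have ha := Valid.alive_of_avoids (t := .orL k t) ⟨i, j, hg, ht, hv⟩ hA
      have hAt : t.Avoids F := fun g hg' => hA g (by simp [PT.gates, hg'])
      simp only [PT.root] at ha ⊢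
      rw [VF_of_or hg, if_pos ha, Finset.mem_union]
      exact Or.inl (ht ▸ Valid.pvars_subset_VF hv hAt w hw)
  | .orR k t, ⟨i, j, hg, ht, hv⟩, hA, w, hw => by
      have ha := Valid.alive_of_avoids (t := .orR k t) ⟨i, j, hg, ht, hv⟩ hA
      have hAt : t.Avoids F := fun g hg' => hA g (by simp [PT.gates, hg'])
      simp only [PT.root] at ha ⊢
      rw [VF_of_or hg, if_pos ha, Finset.mem_union]
      exact Or.inr (ht ▸ Valid.pvars_subset_VF hv hAt w hw)

/-- Every variable of `var((C − F)_k)` is carried by some `F`-avoiding valid certificate of `k`.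
[cite: BovaCapelliMengelSlivovsky2016, §3 (proof of Thm. 6, p. 1012)] -/
theorem exists_valid_of_mem_VF : ∀ (k : Fin m) {x : X}, x ∈ C.VF F k →
    ∃ t, C.Valid t ∧ t.Avoids F ∧ t.root = k ∧ x ∈ t.pvars := by
  suffices H : ∀ (n : ℕ) (k : Fin m), k.val = n → ∀ {x : X}, x ∈ C.VF F k →
      ∃ t, C.Valid t ∧ t.Avoids F ∧ t.root = k ∧ x ∈ t.pvars from fun k => H _ k rfl
  intro n
  induction n using Nat.strong_induction_on with
  | _ n ih =>
    rintro k rfl x hx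
    have ha : C.alive F k = true := alive_of_VF_nonempty ⟨x, hx⟩
    have hk : k ∉ F := not_mem_of_alive ha
    rcases hg : C.node k with b | ⟨w, b⟩ | ⟨i, j⟩ | ⟨i, j⟩
    · rw [VF_of_const hg] at hx; simp at hx
    · have hxw : x = w := by simpa using VF_of_lit hg hx
      subst hxw
      exact ⟨.lit k x b, hg, fun g hg' => by simp [PT.gates] at hg'; exact hg' ▸ hk, rfl,
        by simp [PT.pvars]⟩
    · obtain ⟨hi, hj⟩ := C.lt_of_node_and hg
      have ha' : C.alive F i = true ∧ C.alive F j = true := by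
        have := ha; rw [alive_of_and hg] at this; simpa [hk] using this
      rw [VF_of_and hg, if_pos ha, Finset.mem_union] at hx
      rcases hx with hx | hx
      · obtain ⟨l, hl, hAl, hlr, hxl⟩ := ih i.val hi i rfl hx
        obtain ⟨r, hr, hAr, hrr⟩ := exists_valid_of_alive j ha'.2
        refine ⟨.and k l r, ⟨i, j, hg, hlr, hrr, hl, hr⟩, ?_, rfl, by simp [PT.pvars, hxl]⟩
        intro g hg'
        simp only [PT.gates, List.mem_cons, List.mem_append] at hg'
        rcases hg' with rfl | hg' | hg'
        exacts [hk, hAl g hg', hAr g hg']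
      · obtain ⟨r, hr, hAr, hrr, hxr⟩ := ih j.val hj j rfl hx
        obtain ⟨l, hl, hAl, hlr⟩ := exists_valid_of_alive i ha'.1
        refine ⟨.and k l r, ⟨i, j, hg, hlr, hrr, hl, hr⟩, ?_, rfl, by simp [PT.pvars, hxr]⟩
        intro g hg'
        simp only [PT.gates, List.mem_cons, List.mem_append] at hg'
        rcases hg' with rfl | hg' | hg'
        exacts [hk, hAl g hg', hAr g hg']
    · obtain ⟨hi, hj⟩ := C.lt_of_node_or hg
      rw [VF_of_or hg, if_pos ha, Finset.mem_union] at hx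
      rcases hx with hx | hx
      · obtain ⟨s, hs, hAs, hsr, hxs⟩ := ih i.val hi i rfl hx
        refine ⟨.orL k s, ⟨i, j, hg, hsr, hs⟩, ?_, rfl, by simpa [PT.pvars] using hxs⟩
        intro g hg'
        simp only [PT.gates, List.mem_cons] at hg'
        rcases hg' with rfl | hg'
        exacts [hk, hAs g hg']
      · obtain ⟨s, hs, hAs, hsr, hxs⟩ := ih j.val hj j rfl hx
        refine ⟨.orR k s, ⟨i, j, hg, hsr, hs⟩, ?_, rfl, by simpa [PT.pvars] using hxs⟩
        intro g hg'
        simp only [PT.gates, List.mem_cons] at hg'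
        rcases hg' with rfl | hg'
        exacts [hk, hAs g hg']

/-- **`sat(C − F, g)` is a rectangle** with underlying partition `(Y, X ∖ Y)` for every block `Y`
containing `var((C − F)_g)` and avoiding the off-path variables of the contexts to `g`
(BCMS16 Theorem 1, applied to the circuit `C − F`). [cite: BovaCapelliMengelSlivovsky2016, Thm. 1 (p. 1010)] -/
theorem isRectangle_gateRect {g : Fin m} {Y : Finset X} (hY : C.VF F g ⊆ Y)
    (hY' : ∀ x ∈ Y, ∀ (K : Ctx X m) (s : PT X m), C.Valid (K.plug s) → s.root = g →
      (K.plug s).root = C.out → x ∉ K.cvars) :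
    IsRectangle Y (C.gateRect F g) := by
  rw [isRectangle_iff]
  rintro z ⟨⟨tz, htz, hAz, hrz, hsz⟩, -⟩ z' ⟨-, ⟨K, s, hKs, hKA, hsr, hout, hKz'⟩⟩
  refine ⟨⟨tz, htz, hAz, hrz, ?_⟩, ⟨K, s, hKs, hKA, hsr, hout, ?_⟩⟩
  · refine (PT.sat_congr fun x hx => ?_).2 hsz
    have hxY : x ∈ Y := hY (hrz ▸ Valid.pvars_subset_VF htz hAz x hx)
    exact Finset.piecewise_eq_of_mem _ _ _ hxY
  · refine (Ctx.csat_congr fun x hx => ?_).2 hKz'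
    have hxY : x ∉ Y := fun hxY => hY' x hxY K s hKs hsr hout hx
    exact Finset.piecewise_eq_of_notMem _ _ _ hxY

/-- The block `var((C − F)_g)` qualifies: context variables avoid it (BCMS16 Lemma 2).
[cite: BovaCapelliMengelSlivovsky2016, Lemma 2 (p. 1010)] -/
theorem not_mem_cvars_of_mem_VF (hC : C.IsDecomposable) {g : Fin m} {x : X} (hx : x ∈ C.VF F g)
    (K : Ctx X m) (s : PT X m) (hKs : C.Valid (K.plug s)) (hsr : s.root = g) : x ∉ K.cvars := by
  intro hxK
  obtain ⟨t, ht, -, htr, hxt⟩ := exists_valid_of_mem_VF g hx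
  exact Valid.cvars_disjoint hC hKs x hxK ht (htr.trans hsr.symm) hxt

omit [DecidableEq X] in
/-- Any block containing `var((C − F)_out)` qualifies at the output: a context from the output to
itself is trivial. [folklore] -/
theorem not_mem_cvars_out {x : X} (K : Ctx X m) (s : PT X m) (hKs : C.Valid (K.plug s))
    (hsr : s.root = C.out) (hout : (K.plug s).root = C.out) : x ∉ K.cvars := by
  by_cases hK : K = .hole
  · subst hK; simp [Ctx.cvars]
  · have h := Valid.root_lt_root_plug hKs hK
    rw [hsr, hout] at h
    exact absurd h (lt_irrefl _)

/-- The descent of BCMS16 (proof of Thm. 6): from gate `i`, follow the child with more surviving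
variables until at most `2n/3` remain. [cite: BovaCapelliMengelSlivovsky2016, §3 (proof of Thm. 6, p. 1012)] -/
def descend (C : NNFCircuit X m) (F : Finset (Fin m)) (n : ℕ) (i : Fin m) : Fin m :=
  if 3 * (C.VF F i).card ≤ 2 * n then i
  else
    match h : C.node i with
    | .const _ => i
    | .lit _ _ => i
    | .and h₁ h₂ =>
      have : h₁ < i := C.lt_of_mem_children i h₁ (by simp [h, Node.children])
      have : h₂ < i := C.lt_of_mem_children i h₂ (by simp [h, Node.children])
      if (C.VF F h₂).card ≤ (C.VF F h₁).card then C.descend F n h₁ else C.descend F n h₂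
    | .or h₁ h₂ =>
      have : h₁ < i := C.lt_of_mem_children i h₁ (by simp [h, Node.children])
      have : h₂ < i := C.lt_of_mem_children i h₂ (by simp [h, Node.children])
      if (C.VF F h₂).card ≤ (C.VF F h₁).card then C.descend F n h₁ else C.descend F n h₂
termination_by i

/-- The descent stops once at most `2n/3` variables survive. [folklore] -/
theorem descend_of_le {n : ℕ} {k : Fin m} (h : 3 * (C.VF F k).card ≤ 2 * n) :
    C.descend F n k = k := by
  rw [descend, if_pos h]

/-- The descent at an `∧`-gate follows the child with more surviving variables. [folklore] -/
theorem descend_of_and {n : ℕ} {k i j : Fin m} (hn : ¬3 * (C.VF F k).card ≤ 2 * n)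
    (hg : C.node k = .and i j) :
    C.descend F n k =
      if (C.VF F j).card ≤ (C.VF F i).card then C.descend F n i else C.descend F n j := by
  rw [descend, if_neg hn]; split <;> simp_all

/-- The descent at an `∨`-gate follows the child with more surviving variables. [folklore] -/
theorem descend_of_or {n : ℕ} {k i j : Fin m} (hn : ¬3 * (C.VF F k).card ≤ 2 * n)
    (hg : C.node k = .or i j) :
    C.descend F n k =
      if (C.VF F j).card ≤ (C.VF F i).card then C.descend F n i else C.descend F n j := by
  rw [descend, if_neg hn]; split <;> simp_all

/-- The descent ends in the window `n < 3 |var| ≤ 2n` (BCMS16: "we find a gate `g_i` such that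
`|X|/3 ≤ |var(C^i_{g_i})| ≤ 2|X|/3`"), for `|X| ≠ 1`.
[cite: BovaCapelliMengelSlivovsky2016, §3 (proof of Thm. 6, p. 1012)] -/
theorem descend_window [Fintype X] (hX : Fintype.card X ≠ 1) :
    ∀ k : Fin m, 2 * Fintype.card X < 3 * (C.VF F k).card →
      Fintype.card X < 3 * (C.VF F (C.descend F (Fintype.card X) k)).card ∧
        3 * (C.VF F (C.descend F (Fintype.card X) k)).card ≤ 2 * Fintype.card X := by
  suffices H : ∀ (n : ℕ) (k : Fin m), k.val = n → 2 * Fintype.card X < 3 * (C.VF F k).card →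
      Fintype.card X < 3 * (C.VF F (C.descend F (Fintype.card X) k)).card ∧
        3 * (C.VF F (C.descend F (Fintype.card X) k)).card ≤ 2 * Fintype.card X from
    fun k => H _ k rfl
  intro n
  induction n using Nat.strong_induction_on with
  | _ n ih =>
    rintro k rfl hk
    have hnot : ¬3 * (C.VF F k).card ≤ 2 * Fintype.card X := by omega
    have step : ∀ c : Fin m, c < k → (C.VF F k).card ≤ 2 * (C.VF F c).card →
        Fintype.card X < 3 * (C.VF F (C.descend F (Fintype.card X) c)).card ∧
          3 * (C.VF F (C.descend F (Fintype.card X) c)).card ≤ 2 * Fintype.card X := by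
      intro c hc hcard
      by_cases hsmall : 3 * (C.VF F c).card ≤ 2 * Fintype.card X
      · rw [descend_of_le hsmall]; omega
      · exact ih c.val hc c rfl (by omega)
    rcases hg : C.node k with b | ⟨x, b⟩ | ⟨i, j⟩ | ⟨i, j⟩
    · rw [VF_of_const hg] at hk; simp at hk
    · have h1 : (C.VF F k).card ≤ 1 := by
        simpa using Finset.card_le_card (VF_of_lit (F := F) hg)
      have hpos : 0 < Fintype.card X := Fintype.card_pos_iff.2 ⟨x⟩
      omega
    · obtain ⟨hi, hj⟩ := C.lt_of_node_and hg
      have hle : (C.VF F k).card ≤ (C.VF F i).card + (C.VF F j).card :=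
        (Finset.card_le_card (VF_subset_union_of_and hg)).trans (Finset.card_union_le _ _)
      rw [descend_of_and hnot hg]
      split_ifs with hij
      · exact step i hi (by omega)
      · exact step j hj (by omega)
    · obtain ⟨hi, hj⟩ := C.lt_of_node_or hg
      have hle : (C.VF F k).card ≤ (C.VF F i).card + (C.VF F j).card :=
        (Finset.card_le_card (VF_subset_union_of_or hg)).trans (Finset.card_union_le _ _)
      rw [descend_of_or hnot hg]
      split_ifs with hij
      · exact step i hi (by omega)
      · exact step j hj (by omega)

/-- The descent keeps surviving variables (so its end gate is `alive`). [folklore] -/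
theorem VF_descend_nonempty {n : ℕ} :
    ∀ k : Fin m, (C.VF F k).Nonempty → (C.VF F (C.descend F n k)).Nonempty := by
  suffices H : ∀ (n' : ℕ) (k : Fin m), k.val = n' → (C.VF F k).Nonempty →
      (C.VF F (C.descend F n k)).Nonempty from fun k => H _ k rfl
  intro n'
  induction n' using Nat.strong_induction_on with
  | _ n' ih =>
    rintro k rfl hk
    by_cases hsmall : 3 * (C.VF F k).card ≤ 2 * n
    · rwa [descend_of_le hsmall]
    rcases hg : C.node k with b | ⟨x, b⟩ | ⟨i, j⟩ | ⟨i, j⟩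
    · rw [VF_of_const hg] at hk; exact absurd hk Finset.not_nonempty_empty
    · have : C.descend F n k = k := by rw [descend, if_neg hsmall]; split <;> simp_all
      rwa [this]
    · obtain ⟨hi, hj⟩ := C.lt_of_node_and hg
      have hle : (C.VF F k).card ≤ (C.VF F i).card + (C.VF F j).card :=
        (Finset.card_le_card (VF_subset_union_of_and hg)).trans (Finset.card_union_le _ _)
      have hpos : 0 < (C.VF F k).card := Finset.card_pos.2 hk
      rw [descend_of_and hsmall hg]
      split_ifs with hij
      · exact ih i.val hi i rfl (Finset.card_pos.1 (by omega))
      · exact ih j.val hj j rfl (Finset.card_pos.1 (by omega))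
    · obtain ⟨hi, hj⟩ := C.lt_of_node_or hg
      have hle : (C.VF F k).card ≤ (C.VF F i).card + (C.VF F j).card :=
        (Finset.card_le_card (VF_subset_union_of_or hg)).trans (Finset.card_union_le _ _)
      have hpos : 0 < (C.VF F k).card := Finset.card_pos.2 hk
      rw [descend_of_or hsmall hg]
      split_ifs with hij
      · exact ih i.val hi i rfl (Finset.card_pos.1 (by omega))
      · exact ih j.val hj j rfl (Finset.card_pos.1 (by omega))

end Descent

/-! #### The elimination rounds and the cover -/

section Rounds

variable [Fintype X]

open Classical in
/-- Padding of the root block (second case in the proof of BCMS16 Thm. 6: "adding to `var(C^i)`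
enough variables … so that `(X', X ∖ X')` is a balanced partition"); junk `S` when impossible.
[cite: BovaCapelliMengelSlivovsky2016, §3 (proof of Thm. 6, p. 1012)] -/
noncomputable def pad (S : Finset X) : Finset X :=
  if h : ∃ Y : Finset X, S ⊆ Y ∧ IsBalancedBlock Y then h.choose else S

/-- Padding enlarges the block. [folklore] -/
theorem subset_pad (S : Finset X) : S ⊆ pad S := by
  unfold pad
  split_ifs with h
  · exact h.choose_spec.1
  · exact Finset.Subset.refl _

/-- Padding a block with at most `2|X|/3` variables gives a balanced block (`|X| ≠ 1`). [folklore] -/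
theorem isBalancedBlock_pad {S : Finset X} (hS : 3 * S.card ≤ 2 * Fintype.card X)
    (hX : Fintype.card X ≠ 1) : IsBalancedBlock (pad S) := by
  have h : ∃ Y : Finset X, S ⊆ Y ∧ IsBalancedBlock Y := by
    have hSn : S.card ≤ max S.card ((Fintype.card X + 2) / 3) := le_max_left _ _
    have hn : max S.card ((Fintype.card X + 2) / 3) ≤ (Finset.univ : Finset X).card := by
      rw [Finset.card_univ]
      exact max_le (Finset.card_le_univ S) (by omega)
    obtain ⟨Y, hSY, -, hY⟩ := Finset.exists_subsuperset_card_eq (Finset.subset_univ S) hSn hn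
    refine ⟨Y, hSY, ?_, ?_⟩
    · rw [hY]; omega
    · rw [hY]; omega
  unfold pad
  rw [dif_pos h]
  exact h.choose_spec.2

variable [DecidableEq X] (C : NNFCircuit X m)

/-- One elimination round of BCMS16 (proof of Thm. 6): given the eliminated gates `F`, the next
gate to eliminate and the block of its balanced rectangle — the end of the descent if more than
`2|X|/3` variables survive at the output, else the output itself with a padded block; `none` once
no certificate of the output avoids `F` (`C^l ≡ 0`).
[cite: BovaCapelliMengelSlivovsky2016, §3 (proof of Thm. 6, p. 1012)] -/
noncomputable def step (F : Finset (Fin m)) : Option (Fin m × Finset X) :=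
  if C.alive F C.out = true then
    if 2 * Fintype.card X < 3 * (C.VF F C.out).card then
      some (C.descend F (Fintype.card X) C.out, C.VF F (C.descend F (Fintype.card X) C.out))
    else some (C.out, pad (C.VF F C.out))
  else none

/-- The elimination rounds `(F_i, g_i, Y_i)` of BCMS16 (proof of Thm. 6), with fuel.
[cite: BovaCapelliMengelSlivovsky2016, §3 (proof of Thm. 6, p. 1012)] -/
noncomputable def rounds : ℕ → Finset (Fin m) → List (Finset (Fin m) × Fin m × Finset X)
  | 0, _ => []
  | fuel + 1, F =>
    match C.step F with
    | none => []
    | some p => (F, p) :: rounds fuel (insert p.1 F)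

variable {C}

/-- At most `fuel` rounds. [folklore] -/
theorem length_rounds_le : ∀ (fuel : ℕ) (F : Finset (Fin m)), (C.rounds fuel F).length ≤ fuel
  | 0, _ => by simp [rounds]
  | fuel + 1, F => by
      rw [rounds]
      cases C.step F with
      | none => simp
      | some p => simpa using length_rounds_le fuel _

/-- Every recorded round is a `step`. [folklore] -/
theorem step_eq_of_mem_rounds : ∀ {fuel : ℕ} {F : Finset (Fin m)}
    {e : Finset (Fin m) × Fin m × Finset X}, e ∈ C.rounds fuel F → C.step e.1 = some e.2
  | 0, _, _, h => by simp [rounds] at h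
  | fuel + 1, F, e, h => by
      rw [rounds] at h
      cases hs : C.step F with
      | none => rw [hs] at h; simp at h
      | some p =>
          rw [hs] at h
          simp only [List.mem_cons] at h
          rcases h with rfl | h
          · exact hs
          · exact step_eq_of_mem_rounds h

/-- The eliminated sets only grow along the rounds. [folklore] -/
theorem subset_of_mem_rounds : ∀ {fuel : ℕ} {F : Finset (Fin m)}
    {e : Finset (Fin m) × Fin m × Finset X}, e ∈ C.rounds fuel F → F ⊆ e.1
  | 0, _, _, h => by simp [rounds] at h
  | fuel + 1, F, e, h => by
      rw [rounds] at h
      cases hs : C.step F with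
      | none => rw [hs] at h; simp at h
      | some p =>
          rw [hs] at h
          simp only [List.mem_cons] at h
          rcases h with rfl | h
          · exact Finset.Subset.refl _
          · exact (Finset.subset_insert _ _).trans (subset_of_mem_rounds h)

/-- Each round's gate is eliminated in all later rounds. [folklore] -/
theorem pairwise_rounds : ∀ (fuel : ℕ) (F : Finset (Fin m)),
    (C.rounds fuel F).Pairwise (fun e e' => insert e.2.1 e.1 ⊆ e'.1)
  | 0, _ => by simp [rounds]
  | fuel + 1, F => by
      rw [rounds]
      cases C.step F with
      | none => exact List.Pairwise.nil
      | some p =>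
          exact List.pairwise_cons.2
            ⟨fun e' he' => subset_of_mem_rounds he', pairwise_rounds fuel _⟩

/-- The chosen gate of a round is alive (hence not yet eliminated). [folklore] -/
theorem alive_of_step {F : Finset (Fin m)} {g : Fin m} {Y : Finset X}
    (h : C.step F = some (g, Y)) : C.alive F g = true := by
  unfold step at h
  split_ifs at h with h1 h2
  · obtain ⟨rfl, -⟩ := Prod.mk.inj (Option.some.inj h)
    exact alive_of_VF_nonempty (VF_descend_nonempty _ (Finset.card_pos.1 (by omega)))
  · obtain ⟨rfl, -⟩ := Prod.mk.inj (Option.some.inj h)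
    exact h1

/-- Each round yields a balanced rectangle (BCMS16 proof of Thm. 6: "`R_i` is a balanced rectangle
over `X`"). [cite: BovaCapelliMengelSlivovsky2016, §3 (proof of Thm. 6, p. 1012)] -/
theorem step_spec (hC : C.IsDecomposable) (hX : Fintype.card X ≠ 1) {F : Finset (Fin m)}
    {g : Fin m} {Y : Finset X} (h : C.step F = some (g, Y)) :
    IsBalancedBlock Y ∧ IsRectangle Y (C.gateRect F g) := by
  unfold step at h
  split_ifs at h with h1 h2
  · obtain ⟨rfl, rfl⟩ := Prod.mk.inj (Option.some.inj h)
    have hw := descend_window (C := C) (F := F) hX _ h2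
    refine ⟨⟨by omega, hw.2⟩, isRectangle_gateRect (Finset.Subset.refl _) ?_⟩
    intro x hx K s hKs hsr _
    exact not_mem_cvars_of_mem_VF hC hx K s hKs hsr
  · obtain ⟨rfl, rfl⟩ := Prod.mk.inj (Option.some.inj h)
    refine ⟨isBalancedBlock_pad (by omega) hX, isRectangle_gateRect (subset_pad _) ?_⟩
    intro x _ K s hKs hsr hout
    exact not_mem_cvars_out K s hKs hsr hout

/-- **Every satisfying assignment is caught by some round** (BCMS16: the sets `R_i` cover
`sat(C)`, via Lemma 4 and `C^l ≡ 0`): an `F`-avoiding certificate of the output is caught by the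
rounds started at `F`, provided the fuel covers the gates not yet eliminated.
[cite: BovaCapelliMengelSlivovsky2016, §3 (proof of Thm. 6, p. 1012)] -/
theorem exists_mem_rounds {z : X → Bool} : ∀ (fuel : ℕ) (F : Finset (Fin m)),
    m ≤ fuel + F.card →
    ∀ {T : PT X m}, C.Valid T → T.Avoids F → T.root = C.out → T.Sat z →
      ∃ e ∈ C.rounds fuel F, z ∈ C.gateRect e.1 e.2.1
  | 0, F, hsz, T, hT, hA, hr, hs => by
      exfalso
      have hEq : F = Finset.univ :=
        Finset.eq_univ_of_card F (le_antisymm (Finset.card_le_univ F) (by simpa using hsz))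
      have hout : C.out ∈ F := hEq ▸ Finset.mem_univ _
      exact hA _ (hr ▸ T.root_mem_gates) hout
  | fuel + 1, F, hsz, T, hT, hA, hr, hs => by
      have halive : C.alive F C.out = true := hr ▸ Valid.alive_of_avoids hT hA
      have hstep : ∃ p, C.step F = some p := by
        unfold step; rw [if_pos halive]; split_ifs <;> exact ⟨_, rfl⟩
      obtain ⟨⟨g, Y⟩, hp⟩ := hstep
      rw [rounds, hp]
      by_cases hg : g ∈ T.gates
      · exact ⟨(F, g, Y), by simp, mem_gateRect_of_mem_gates hT hA hr hs hg⟩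
      · have hgF : g ∉ F := not_mem_of_alive (alive_of_step hp)
        have hA' : T.Avoids (insert g F) := by
          intro x hx hx'
          rcases Finset.mem_insert.1 hx' with rfl | hx'
          · exact hg hx
          · exact hA x hx hx'
        have hsz' : m ≤ fuel + (insert g F).card := by
          rw [Finset.card_insert_of_notMem hgF]; omega
        obtain ⟨e, he, hze⟩ := exists_mem_rounds fuel (insert g F) hsz' hT hA' hr hs
        exact ⟨e, List.mem_cons_of_mem _ he, hze⟩

/-- **Bova–Capelli–Mengel–Slivovsky, Theorem 6** (both halves, for `|X| ≠ 1`, with no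
constant-freeness or `var(C) = X` hypothesis): a decomposable NNF `C` with `m` gates has a
balanced rectangle cover of `f_C⁻¹(1)` by at most `m` rectangles, pairwise disjoint when `C` is
moreover deterministic. [cite: BovaCapelliMengelSlivovsky2016, Thm. 6 (p. 1011)] -/
theorem exists_balancedCover (hX : Fintype.card X ≠ 1) (hC : C.IsDecomposable) :
    ∃ t ≤ m, ∃ (K : Fin t → Finset X) (R : Fin t → Set (X → Bool)),
      (∀ i, IsBalancedBlock (K i) ∧ IsRectangle (K i) (R i)) ∧
        ⋃ i, R i = {z | C.fn z = true} ∧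
          (C.IsDeterministic → Pairwise (fun i j => Disjoint (R i) (R j))) := by
  set L := C.rounds m ∅ with hL
  have hstep : ∀ i : Fin L.length, C.step (L.get i).1 = some ((L.get i).2.1, (L.get i).2.2) :=
    fun i => step_eq_of_mem_rounds (List.get_mem L i)
  refine ⟨L.length, length_rounds_le _ _, fun i => (L.get i).2.2,
    fun i => C.gateRect (L.get i).1 (L.get i).2.1, fun i => step_spec hC hX (hstep i), ?_, ?_⟩
  · ext z
    simp only [Set.mem_iUnion, Set.mem_setOf_eq]
    constructor
    · rintro ⟨i, hi⟩
      exact C.gateRect_subset_sat _ _ hi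
    · intro hz
      obtain ⟨T, hT, hr, hs⟩ := (C.eval_eq_true_iff z C.out).1 hz
      obtain ⟨e, he, hze⟩ :=
        exists_mem_rounds (z := z) m ∅ (by simp) hT (fun g _ h => by simp at h) hr hs
      obtain ⟨i, rfl⟩ := List.mem_iff_get.1 he
      exact ⟨i, hze⟩
  · intro hD i j hij
    have hpw := pairwise_rounds (C := C) m ∅
    rw [List.pairwise_iff_get] at hpw
    rcases lt_or_gt_of_ne hij with h | h
    · exact gateRect_disjoint hD (hpw i j h (Finset.mem_insert_self _ _))
    · exact (gateRect_disjoint hD (hpw j i h (Finset.mem_insert_self _ _))).symm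

end Rounds

end NNFCircuit

/-- **Discharge of `BCMS2016_balancedCover_of_DNNF`** (Bova–Capelli–Mengel–Slivovsky 2016,
Thm. 6): proved from `NNFCircuit.exists_balancedCover`; the constant-freeness and `var(C) = X`
hypotheses of the fact are not needed. [cite: BovaCapelliMengelSlivovsky2016, Thm. 6 (p. 1011)] -/
theorem BCMS2016_balancedCover_of_DNNF_holds : BCMS2016_balancedCover_of_DNNF := by
  intro X _ _ hX m C hd _ _
  obtain ⟨t, ht, K, R, hKR, hU, hD⟩ := NNFCircuit.exists_balancedCover (C := C) hX hd
  exact ⟨⟨t, ht, K, R, hKR, hU⟩, fun hdet => ⟨t, ht, K, R, hKR, hD hdet, hU⟩⟩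

end Literature.Computability.Complexity
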